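import Literature.Computability.Complexity.UmansFPField
import Literature.Computability.Complexity.TVSelfCorrect
import Literature.Computability.Complexity.CodeFPListKit
import Literature.Computability.Complexity.GF2StringArith
import Literature.Computability.Complexity.MajorityEnumeration
import Literature.Computability.Complexity.TVSelfCorrectCoins
import Literature.Computability.Complexity.CodeFPStringKit
import Literature.Computability.Complexity.CodeFPStrings
import Literature.Computability.Complexity.StackBricksStrings
import Literature.Computability.Complexity.HashBricks
import Literature.Computability.Complexity.TVCheckerParse
import Literature.InformationTheory.Coding.BCHExplicitFP
import HarnessLib

/-!
# The self-corrector of Trevisan–Vadhan's `F` as a polynomial-time machine (IW98 Def. 5 / TV07 Lemma 3.5,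
# "the well-known self-corrector for multivariate polynomials"), in three parts

Literature / complexity — derandomization under a uniform assumption (Impagliazzo–Wigderson 1998, Case 2,
in Trevisan–Vadhan's form). The random self-reduction `C^{F,1−ρ} → C^F` of Trevisan–Vadhan's
`PSPACE`-complete `F` is COUNTED in `TVSelfCorrect.lean` … `TVSelfCorrectCoins.lean` and CONSUMED, as two
equations on an evaluator `Ev'` (`hspec`, `hspec0`), by `UniformDerandomizationRSRBridge.lean` and
`UniformDerandomizationHolds.lean`. This file BUILDS that evaluator:
**`TVCorr.exists_corrector`** — for every `Ev ∈ FP` an `Ev' ∈ FP` reading `⟨⟨d, ⟨1ᵃ, c⟩⟩, w⟩` at every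
canonical length `|w| = h n i` as `majCorrected (descFn Ev d) n (decodeTrials n i (trialsOf (2a)) c) w` and
answering `0` off the canonical lengths. Field elements travel as the bitmasks of their power-basis
coordinates (Umans' kit `UmansFPField.lean`, the modulus context as data, so the machine is uniform in the
field size); every function is certified in the typed polynomial-time calculus `CodeFP`, and its meaning is
proved against `PolySelfCorrect.trial/corr/plurality` and `QBFUniv.ptOracle/corrected/majCorrected`.
Part I: field layer (line points, Lagrange weights at `0`, weighted sums, plurality). Part II: the oracle
layer (blocks, query words `= wordPad`, answer masks `= ptOracle`, trials `= trial`, values `= corr`,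
corrected bit `= corrected`). Part III: the trials of a coin string, the majority (`= majCorrected`), the
parsing of the length (`TVCheckerParse.lean` bricks, `irredSearch`), the evaluator.

Everything is proved; definitions are plain functions on numerals and strings (no named facts).

## References

* [TrevisanVadhan2007] L. Trevisan, S. Vadhan, Comput. Complexity 16 (2007), Lemma 3.5, Thm. 4.3 (proof).
* [ImpagliazzoWigderson2001] R. Impagliazzo, A. Wigderson, JCSS 63 (2001), §2.2 Defs. 4–5.
* [AroraBarakCC2009] S. Arora, B. Barak, CUP 2009, §19.4.2 (Reed–Muller local decoder), §7.4.1, §1.3, §3.4.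
* [Umans2003] C. Umans, JCSS 67 (2003), §3 (field elements as vectors; the bitmask kit).
-/

/-!
# Part I — field elements as bitmasks, points of a
# random line, Lagrange weights at `0`, the weighted sum and the plurality (typed polynomial time)

Literature / complexity — derandomization under a uniform assumption (IW98 Case 2 in TV07 form), first
MACHINE layer of the random self-reduction `C^{F,1−ρ} → C^F` (IW98 Def. 5; TV07 Lemma 3.5 "the
well-known self-corrector for multivariate polynomials"), whose counting is `TVSelfCorrect*.lean`. The
corrector evaluates, at the `Dn n + 1` nonzero nodes `τ_a = [a+1]` of a random line `x + τ y` through the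
queried point, an approximate oracle for `f_{n,i} : K^{N} → K` (`K = GF(2^{blk n})`), interpolates to `0`
with the Lagrange weights `λ_a = Π_{b ≠ a} τ_b (τ_a + τ_b)⁻¹`, and takes the plurality of several lines.
Here the field elements travel as the BITMASKS `< 2^{blk n}` of their power-basis coordinates
(`GF2.elt`, Umans' kit `UmansFPField.lean`: `kmul`, `kinv`, the modulus context `kctx M` as DATA, so the
machine is uniform in the field size), and every operation is certified in the typed polynomial-time
calculus `CodeFP`:

* bridges: `TVCorr.encF_elt` (coordinates of `elt k` are the bits of `k`), `TVCorr.elt_bitsToNat_ofFn`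
  (`elt (bitsToNat (ofFn w)) = decF w`), `TVCorr.natBits_eq_ofFn_encF`;
* field operations on masks relative to a context `κ = (W, f, P)`: `TVCorr.fadd`, `fmul`, `finv` with
  `CodeFP` forms and their meaning for `κ = kctx M` (`elt_fadd`, `elt_fmul`, `elt_finv`);
* `TVCorr.linePt κ τ x y` — the point `x + τ y` coordinatewise (`linePtC`, `elt_linePt_get`);
* `TVCorr.wt κ D a` — the weight `λ_a` as a product fold (`wtC`, **`elt_wt`**: it is
  `PolySelfCorrect.weight (nodes n) a`);
* `TVCorr.wsum κ D ws vs` — `Σ_a λ_a · v_a` as a xor fold (`wsumC`, **`elt_wsum`**);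
* `TVCorr.plur vals` — the plurality mask (`plurC`, **`elt_plur`**: it is `PolySelfCorrect.plurality`).

Everything is proved; definitions are plain functions on numerals (no named facts). The oracle layer
(query words, answers, trials, majority, parsing) is Parts II–III.

## References

* [TrevisanVadhan2007] L. Trevisan, S. Vadhan, Comput. Complexity 16 (2007), Lemma 3.5, Thm. 4.3 (proof).
* [ImpagliazzoWigderson2001] R. Impagliazzo, A. Wigderson, JCSS 63 (2001), §2.2 Def. 5.
* [AroraBarakCC2009] S. Arora, B. Barak, CUP 2009, §19.4.2 (Reed–Muller local decoder), §1.3.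
* [Umans2003] C. Umans, JCSS 67 (2003), §3 (field elements as vectors; the bitmask kit).
-/

noncomputable section

namespace Literature.Computability.Complexity

namespace TVCorr

open _root_.Computability Polynomial Finset Literature.InformationTheory.Coding Literature.InformationTheory.Coding.GF2X
  UmansFP PolySelfCorrect
open CodeFP (strE bitE unE natE pairE rawE unitE pairE_apply rawE_cons rawE_nil length_unE length_natE)

open scoped Classical

/-! ### Bridges: bitmasks, coordinates, bit strings -/

/-- **The coordinates of `elt M k` are the bits of `k`** (`k < 2^{M+1}`). [cite: Umans2003, §3] -/
theorem encF_elt {M k : ℕ} (hk : k < 2 ^ (M + 1)) (l : Fin (M + 1)) : encF M (GF2.elt M k) l = k.testBit l.val := by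
  unfold encF
  rw [GF2.elt, GF2.basis_repr_mk, modByMonic_bitsPoly_of_lt (monic_canonIrred M) ?_ hk, coeff_bitsPoly]
  · by_cases hb : k.testBit l.val = true <;> simp [hb] <;> decide
  · rw [degree_eq_natDegree (monic_canonIrred M).ne_zero, natDegree_canonIrred]

/-- `bitsToNat (ofFn w)` has the bits `w`. [folklore] -/
theorem testBit_bitsToNat_ofFn {L : ℕ} (w : Fin L → Bool) (l : Fin L) : (bitsToNat (List.ofFn w)).testBit l.val = w l := by
  have h1 := GF2Str.getD_natBits L (bitsToNat (List.ofFn w)) l.val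
  have h2 : natBits L (bitsToNat (List.ofFn w)) = List.ofFn w := by
    simpa using CoinEnum.natBits_bitsToNat (List.ofFn w)
  rw [h2, List.getD_eq_getElem?_getD, List.getElem?_ofFn] at h1
  simp [l.isLt] at h1
  exact h1.symm

/-- **`elt (bitsToNat (ofFn w)) = decF w`**: the mask of a coordinate vector names its element. [folklore] -/
theorem elt_bitsToNat_ofFn {M : ℕ} (w : Fin (M + 1) → Bool) : GF2.elt M (bitsToNat (List.ofFn w)) = decF M w := by
  apply encF_injective M
  funext l
  rw [encF_elt (by simpa using bitsToNat_lt (List.ofFn w)), encF_decF, testBit_bitsToNat_ofFn]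

/-- Masks `< 2^{M+1}` are determined by their elements. [folklore] -/
theorem mask_eq_bitsToNat_ofFn {M k : ℕ} (hk : k < 2 ^ (M + 1)) : k = bitsToNat (List.ofFn (encF M (GF2.elt M k))) := by
  apply Nat.eq_of_testBit_eq
  intro j
  by_cases hj : j < M + 1
  · rw [testBit_bitsToNat_ofFn _ ⟨j, hj⟩, encF_elt hk]
  · have h1 : k < 2 ^ j := hk.trans_le (Nat.pow_le_pow_right Nat.two_pos (by omega))
    have h2 : bitsToNat (List.ofFn (encF M (GF2.elt M k))) < 2 ^ j :=
      (bitsToNat_lt _).trans_le (Nat.pow_le_pow_right Nat.two_pos (by simp; omega))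
    rw [Nat.testBit_lt_two_pow h1, Nat.testBit_lt_two_pow h2]

/-- **The `M+1` bits of a mask `< 2^{M+1}` are the coordinates of its element.** [folklore] -/
theorem natBits_eq_ofFn_encF {M k : ℕ} (hk : k < 2 ^ (M + 1)) : natBits (M + 1) k = List.ofFn (encF M (GF2.elt M k)) := by
  conv_lhs => rw [mask_eq_bitsToNat_ofFn hk]
  simpa using CoinEnum.natBits_bitsToNat (List.ofFn (encF M (GF2.elt M k)))

/-- `elt M 0 = 0`. [folklore] -/
theorem elt_zero (M : ℕ) : GF2.elt M 0 = 0 := by rw [GF2.elt, bitsPoly_zero, map_zero]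

/-! ### Field operations on masks, relative to a context `κ = (W, f, P)` -/

/-- Addition: bitwise sum of the low `W` bits. [cite: Umans2003, §3] -/
def fadd (κ : ℕ × ℕ × ℕ) (a b : ℕ) : ℕ := xorW κ.1 a b

/-- Multiplication modulo the carried modulus. [cite: Umans2003, §3] -/
def fmul (κ : ℕ × ℕ × ℕ) (a b : ℕ) : ℕ := mulMod κ.1 κ.2.1 κ.2.2 κ.1 a b

/-- The Fermat inverse `a^{P−2}`. [cite: Umans2003, §3] -/
def finv (κ : ℕ × ℕ × ℕ) (a : ℕ) : ℕ := kpowB κ a (κ.2.2 - 2) κ.1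

/-- `fadd` on codes. [cite: AroraBarakCC2009, §1.3] -/
theorem faddC : CodeFP (pairE kctxE (pairE natE natE)) natE (fun p => fadd p.1 p.2.1 p.2.2) :=
  (xorFP.comp ((CodeFP.fst _ _).fst'.pair (CodeFP.snd _ _))).congr fun _ => rfl

/-- `fmul` on codes. [cite: AroraBarakCC2009, §1.3] -/
theorem fmulC : CodeFP (pairE kctxE (pairE natE natE)) natE (fun p => fmul p.1 p.2.1 p.2.2) :=
  kmulFP.congr fun _ => rfl

/-- `finv` on codes. [cite: AroraBarakCC2009, §1.3] -/
theorem finvC : CodeFP (pairE kctxE natE) natE (fun p => finv p.1 p.2) :=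
  kinvFP.congr fun _ => rfl

/-- `fmul` is always reduced below `2^W`. [folklore] -/
theorem fmul_lt (κ : ℕ × ℕ × ℕ) (a b : ℕ) : fmul κ a b < 2 ^ κ.1 := mulMod_lt _ _ _ _ _ _

/-- `fadd` is always reduced below `2^W`. [folklore] -/
theorem fadd_lt (κ : ℕ × ℕ × ℕ) (a b : ℕ) : fadd κ a b < 2 ^ κ.1 := xorW_lt _ _ _

variable {M : ℕ}

/-- **Meaning of `fadd`** in the context of `GF(2^{M+1})`. [cite: Umans2003, §3] -/
theorem elt_fadd {a b : ℕ} (ha : a < 2 ^ (M + 1)) (hb : b < 2 ^ (M + 1)) :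
    GF2.elt M (fadd (kctx M) a b) = GF2.elt M a + GF2.elt M b ∧ fadd (kctx M) a b < 2 ^ (M + 1) :=
  elt_xorW M (by simp [kctx]) ha hb

/-- **Meaning of `fmul`.** [cite: Umans2003, §3] -/
theorem elt_fmul {a b : ℕ} (ha : a < 2 ^ (M + 1)) (hb : b < 2 ^ (M + 1)) :
    GF2.elt M (fmul (kctx M) a b) = GF2.elt M a * GF2.elt M b ∧ fmul (kctx M) a b < 2 ^ (M + 1) := by
  have h := kmul_spec M ha hb
  rwa [kmul_eq_mulMod] at h

/-- **Meaning of `finv`** on a nonzero element. [cite: Umans2003, §3] -/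
theorem elt_finv {a : ℕ} (ha : a < 2 ^ (M + 1)) (h0 : GF2.elt M a ≠ 0) :
    GF2.elt M (finv (kctx M) a) = (GF2.elt M a)⁻¹ ∧ finv (kctx M) a < 2 ^ (M + 1) := by
  have h := kinv_spec M ha h0
  rwa [kinv_eq] at h

/-! ### The point `x + τ y` of a line -/

/-- **The point `x + τ y`**, coordinatewise on masks. [cite: AroraBarakCC2009, §19.4.2] -/
def linePt (κ : ℕ × ℕ × ℕ) (τ : ℕ) (x y : List ℕ) : List ℕ := List.zipWith (fun xi yi => fadd κ xi (fmul κ τ yi)) x y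

/-- `linePt` on codes (context `(κ, τ)`, arguments `(x, y)`). [cite: AroraBarakCC2009, §1.3] -/
theorem linePtC : CodeFP (pairE (pairE kctxE natE) (pairE (rawE natE) (rawE natE))) (rawE natE)
    (fun p => linePt p.1.1 p.1.2 p.2.1 p.2.2) := by
  have hg : CodeFP (pairE (pairE kctxE natE) (pairE natE natE)) natE
      (fun t => fadd t.1.1 t.2.1 (fmul t.1.1 t.1.2 t.2.2)) :=
    faddC.comp ((CodeFP.fst _ _).fst'.pair ((CodeFP.snd _ _).fst'.pair
      (fmulC.comp ((CodeFP.fst _ _).fst'.pair ((CodeFP.fst _ _).snd'.pair (CodeFP.snd _ _).snd')))))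
  exact (CodeFP.zipWith hg).congr fun _ => rfl

/-- Length of the line point. [folklore] -/
theorem length_linePt (κ : ℕ × ℕ × ℕ) (τ : ℕ) {x y : List ℕ} (h : x.length = y.length) :
    (linePt κ τ x y).length = x.length := by
  rw [linePt, List.length_zipWith, h, min_self]

/-- Coordinate `v` of the line point. [folklore] -/
theorem getD_linePt (κ : ℕ × ℕ × ℕ) (τ : ℕ) {x y : List ℕ} (hlen : x.length = y.length) {v : ℕ} (hv : v < x.length) :
    (linePt κ τ x y).getD v 0 = fadd κ (x.getD v 0) (fmul κ τ (y.getD v 0)) := by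
  have hvy : v < y.length := hlen ▸ hv
  have hvz : v < (linePt κ τ x y).length := by rw [length_linePt _ _ hlen]; exact hv
  rw [List.getD_eq_getElem _ _ hvz, List.getD_eq_getElem _ _ hv, List.getD_eq_getElem _ _ hvy]
  simp only [linePt, List.getElem_zipWith]

/-- **Meaning of `linePt`**: coordinate `v` is `x_v + τ y_v`. [cite: AroraBarakCC2009, §19.4.2] -/
theorem elt_linePt_get {τ : ℕ} (hτ : τ < 2 ^ (M + 1)) {x y : List ℕ} (hlen : x.length = y.length)
    (hx : ∀ v ∈ x, v < 2 ^ (M + 1)) (hy : ∀ v ∈ y, v < 2 ^ (M + 1)) {v : ℕ} (hv : v < x.length) :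
    GF2.elt M ((linePt (kctx M) τ x y).getD v 0) =
        GF2.elt M (x.getD v 0) + GF2.elt M τ * GF2.elt M (y.getD v 0) ∧
      (linePt (kctx M) τ x y).getD v 0 < 2 ^ (M + 1) := by
  have hvy : v < y.length := hlen ▸ hv
  have hxv : x.getD v 0 < 2 ^ (M + 1) := by rw [List.getD_eq_getElem _ _ hv]; exact hx _ (List.getElem_mem hv)
  have hyv : y.getD v 0 < 2 ^ (M + 1) := by rw [List.getD_eq_getElem _ _ hvy]; exact hy _ (List.getElem_mem hvy)
  obtain ⟨hm1, hm2⟩ := elt_fmul (M := M) hτ hyv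
  obtain ⟨ha1, ha2⟩ := elt_fadd (M := M) hxv hm2
  rw [getD_linePt _ _ hlen hv]
  exact ⟨by rw [ha1, hm1], ha2⟩

/-- All coordinates of the line point are reduced. [folklore] -/
theorem linePt_lt {τ : ℕ} (hτ : τ < 2 ^ (M + 1)) {x y : List ℕ} (hlen : x.length = y.length)
    (hx : ∀ v ∈ x, v < 2 ^ (M + 1)) (hy : ∀ v ∈ y, v < 2 ^ (M + 1)) : ∀ v ∈ linePt (kctx M) τ x y, v < 2 ^ (M + 1) := by
  intro w hw
  obtain ⟨v, hv, rfl⟩ := List.getElem_of_mem hw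
  have hv' : v < x.length := by rwa [length_linePt _ _ hlen] at hv
  have := (elt_linePt_get hτ hlen hx hy hv').2
  rwa [List.getD_eq_getElem _ _ hv] at this

/-! ### Reduced accumulators: a size bound for the folds -/

/-- A reduced mask has a short numeral: `k < 2^W → |bin k| ≤ W`. [folklore] -/
theorem length_natE_le_of_lt {k W : ℕ} (h : k < 2 ^ W) : (natE k).length ≤ W := by
  rw [length_natE]; exact Nat.size_le.2 h

/-- The context code is longer than `W`. [folklore] -/
theorem fst_le_length_kctxE (κ : ℕ × ℕ × ℕ) : κ.1 ≤ (kctxE κ).length := by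
  obtain ⟨W, f, P⟩ := κ
  simp only [kctxE, pairE_apply, length_boolPair, length_unE]
  omega

/-! ### The Lagrange weights at `0` -/

/-- One factor of the weight product: skip `b = a`, else multiply by `τ_b (τ_a + τ_b)⁻¹` with the nodes
`τ_c = [c + 1]`. [cite: AroraBarakCC2009, §19.4.2] -/
def wtStep (κ : ℕ × ℕ × ℕ) (a acc b : ℕ) : ℕ :=
  if b == a then acc else fmul κ acc (fmul κ (b + 1) (finv κ (fadd κ (a + 1) (b + 1))))

/-- **The weight `λ_a = Π_{b ≤ D, b ≠ a} τ_b (τ_a + τ_b)⁻¹`** as a product fold. [cite: AroraBarakCC2009, §19.4.2] -/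
def wt (κ : ℕ × ℕ × ℕ) (D a : ℕ) : ℕ := (List.range (D + 1)).foldl (wtStep κ a) 1

/-- `wtStep` on codes (context `(κ, a)`, arguments `(b, acc)`). [cite: AroraBarakCC2009, §1.3] -/
theorem wtStepC : CodeFP (pairE (pairE kctxE natE) (pairE natE natE)) natE (fun t => wtStep t.1.1 t.1.2 t.2.2 t.2.1) := by
  have hκ : CodeFP (pairE (pairE kctxE natE) (pairE natE natE)) kctxE (fun t => t.1.1) := (CodeFP.fst _ _).fst'
  have ha : CodeFP (pairE (pairE kctxE natE) (pairE natE natE)) natE (fun t => t.1.2) := (CodeFP.fst _ _).snd'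
  have hb : CodeFP (pairE (pairE kctxE natE) (pairE natE natE)) natE (fun t => t.2.1) := (CodeFP.snd _ _).fst'
  have hacc : CodeFP (pairE (pairE kctxE natE) (pairE natE natE)) natE (fun t => t.2.2) := (CodeFP.snd _ _).snd'
  have h1 : CodeFP (pairE (pairE kctxE natE) (pairE natE natE)) natE (fun t => t.1.2 + 1) := CodeFP.natAdd.comp (ha.pair (CodeFP.const _ 1))
  have h2 : CodeFP (pairE (pairE kctxE natE) (pairE natE natE)) natE (fun t => t.2.1 + 1) := CodeFP.natAdd.comp (hb.pair (CodeFP.const _ 1))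
  have hinv : CodeFP (pairE (pairE kctxE natE) (pairE natE natE)) natE (fun t => finv t.1.1 (fadd t.1.1 (t.1.2 + 1) (t.2.1 + 1))) :=
    finvC.comp (hκ.pair (faddC.comp (hκ.pair (h1.pair h2))))
  have hprod : CodeFP (pairE (pairE kctxE natE) (pairE natE natE)) natE
      (fun t => fmul t.1.1 t.2.2 (fmul t.1.1 (t.2.1 + 1) (finv t.1.1 (fadd t.1.1 (t.1.2 + 1) (t.2.1 + 1))))) :=
    fmulC.comp (hκ.pair (hacc.pair (fmulC.comp (hκ.pair (h2.pair hinv)))))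
  exact (((CodeFP.beq CodeFP.natE_injective).comp (hb.pair ha)).ite hacc hprod).congr fun t => by simp only [wtStep]

/-- The weight accumulator is `1` or reduced. [folklore] -/
theorem wt_foldl_bound (κ : ℕ × ℕ × ℕ) (a : ℕ) (l : List ℕ) {acc : ℕ} (hacc : acc = 1 ∨ acc < 2 ^ κ.1) :
    l.foldl (wtStep κ a) acc = 1 ∨ l.foldl (wtStep κ a) acc < 2 ^ κ.1 := by
  induction l generalizing acc with
  | nil => exact hacc
  | cons b l ih =>
    rw [List.foldl_cons]
    refine ih ?_
    unfold wtStep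
    split_ifs
    · exact hacc
    · exact Or.inr (fmul_lt _ _ _)

/-- **`wt` on codes**: `((κ, a), 1^{D+1}) ↦ wt κ D a`. [cite: AroraBarakCC2009, §1.3 (bounded loops)] -/
theorem wtC : CodeFP (pairE (pairE kctxE natE) unE) natE (fun p => (List.range p.2).foldl (wtStep p.1.1 p.1.2) 1) := by
  have hfold := CodeFP.foldl (σ := (ℕ × ℕ × ℕ) × ℕ) (eσ := pairE kctxE natE) (eα := natE) (eβ := natE)
    (step := fun s b acc => wtStep s.1 s.2 acc b) (init := fun _ => 1) wtStepC (CodeFP.const _ 1) (X + 1)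
    (fun s l₁ l₂ => by
      rcases wt_foldl_bound s.1 s.2 l₁ (acc := 1) (Or.inl rfl) with h1 | h1
      · rw [h1, eval_add, eval_X, eval_one]; exact le_add_self
      · refine (length_natE_le_of_lt h1).trans ?_
        rw [eval_add, eval_X, eval_one, pairE_apply, length_boolPair, pairE_apply, length_boolPair]
        dsimp only
        have := fst_le_length_kctxE s.1
        omega)
  exact (hfold.comp ((CodeFP.fst _ _).pair (CodeFP.urange.comp (CodeFP.snd _ _)))).congr fun _ => rfl

/-! ### The weighted sum `Σ_j w_j v_j` -/

/-- One term of the weighted sum: add `w_j · v_j`. [folklore] -/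
def wsumStep (κ : ℕ × ℕ × ℕ) (ws vs : List ℕ) (acc j : ℕ) : ℕ := fadd κ acc (fmul κ (ws.getD j 0) (vs.getD j 0))

/-- **The weighted sum `Σ_{j < |ws|} w_j v_j`** as a xor fold. [cite: AroraBarakCC2009, §19.4.2] -/
def wsum (κ : ℕ × ℕ × ℕ) (ws vs : List ℕ) : ℕ := (List.range ws.length).foldl (wsumStep κ ws vs) 0

/-- `wsumStep` on codes (context `(κ, ws, vs)`, arguments `(j, acc)`). [cite: AroraBarakCC2009, §1.3] -/
theorem wsumStepC : CodeFP (pairE (pairE kctxE (pairE (rawE natE) (rawE natE))) (pairE natE natE)) natE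
    (fun t => wsumStep t.1.1 t.1.2.1 t.1.2.2 t.2.2 t.2.1) := by
  have hκ : CodeFP (pairE (pairE kctxE (pairE (rawE natE) (rawE natE))) (pairE natE natE)) kctxE (fun t => t.1.1) := (CodeFP.fst _ _).fst'
  have hj : CodeFP (pairE (pairE kctxE (pairE (rawE natE) (rawE natE))) (pairE natE natE)) natE (fun t => t.2.1) := (CodeFP.snd _ _).fst'
  have hw : CodeFP (pairE (pairE kctxE (pairE (rawE natE) (rawE natE))) (pairE natE natE)) natE (fun t => t.1.2.1.getD t.2.1 0) :=
    (CodeFP.rawGetD natE (d := 0) rfl).comp ((CodeFP.fst _ _).snd'.fst'.pair hj)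
  have hv : CodeFP (pairE (pairE kctxE (pairE (rawE natE) (rawE natE))) (pairE natE natE)) natE (fun t => t.1.2.2.getD t.2.1 0) :=
    (CodeFP.rawGetD natE (d := 0) rfl).comp ((CodeFP.fst _ _).snd'.snd'.pair hj)
  exact (faddC.comp (hκ.pair ((CodeFP.snd _ _).snd'.pair (fmulC.comp (hκ.pair (hw.pair hv)))))).congr fun _ => rfl

/-- **`wsum` on codes**: `(κ, ws, vs) ↦ wsum κ ws vs`. [cite: AroraBarakCC2009, §1.3 (bounded loops)] -/
theorem wsumC : CodeFP (pairE kctxE (pairE (rawE natE) (rawE natE))) natE (fun p => wsum p.1 p.2.1 p.2.2) := by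
  have hfold := CodeFP.foldl (σ := (ℕ × ℕ × ℕ) × List ℕ × List ℕ) (eσ := pairE kctxE (pairE (rawE natE) (rawE natE)))
    (eα := natE) (eβ := natE) (step := fun s j acc => wsumStep s.1 s.2.1 s.2.2 acc j) (init := fun _ => 0)
    wsumStepC (CodeFP.const _ 0) X (fun s l₁ l₂ => by
      have hb : ∀ (l : List ℕ) (acc : ℕ), acc < 2 ^ s.1.1 → l.foldl (fun acc j => wsumStep s.1 s.2.1 s.2.2 acc j) acc < 2 ^ s.1.1 := by
        intro l
        induction l with
        | nil => intro acc h; exact h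
        | cons j l ih => intro acc _; rw [List.foldl_cons]; exact ih _ (fadd_lt _ _ _)
      refine (length_natE_le_of_lt (hb l₁ 0 (Nat.two_pow_pos _))).trans ?_
      rw [eval_X, pairE_apply, length_boolPair, pairE_apply, length_boolPair]
      dsimp only
      have := fst_le_length_kctxE s.1
      omega)
  exact (hfold.comp ((CodeFP.id _).pair (CodeFP.urange.comp ((CodeFP.ulength natE).comp (CodeFP.snd _ _).fst')))).congr
    fun _ => rfl

/-! ### The plurality -/

/-- **The plurality mask**: the first entry carried by more than half of the list, else `0`.
[cite: AroraBarakCC2009, Thm. 7.10 (majority vote)] -/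
def plur (vals : List ℕ) : ℕ := (vals.find? fun v => decide (vals.length < 2 * vals.count v)).getD 0

/-- `plur` on codes. [cite: AroraBarakCC2009, §1.3] -/
theorem plurC : CodeFP (rawE natE) natE plur := by
  have hp : CodeFP (pairE (rawE natE) natE) bitE (fun t => decide (t.1.length < 2 * t.1.count t.2)) :=
    CodeFP.natLt.comp (((CodeFP.natLength natE).comp (CodeFP.fst _ _)).pair
      (CodeFP.natMul.comp ((CodeFP.const _ 2).pair (CodeFP.rawCountNat.comp ((CodeFP.snd _ _).pair (CodeFP.fst _ _))))))
  have hfind := CodeFP.rawFind? (σ := List ℕ) (eσ := rawE natE) (eα := natE) (p := fun t => decide (t.1.length < 2 * t.1.count t.2)) hp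
  have hcase := CodeFP.optCases (σ := Unit) (eσ := unitE) (eα := natE) (eδ := natE)
    (k := fun _ o => o.getD 0) (gnone := fun _ => 0) (gsome := fun t => t.2)
    (CodeFP.const _ 0) (CodeFP.snd _ _) (fun _ => rfl) (fun _ _ => rfl)
  exact (hcase.comp ((CodeFP.const _ ()).pair (hfind.comp ((CodeFP.id _).pair (CodeFP.id _))))).congr fun _ => rfl

/-- The plurality is an entry of the list, or `0`. [folklore] -/
theorem plur_mem_or (vals : List ℕ) : plur vals ∈ vals ∨ plur vals = 0 := by
  rw [plur]
  cases hf : vals.find? (fun v => decide (vals.length < 2 * vals.count v)) with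
  | none => exact Or.inr rfl
  | some u => exact Or.inl (List.mem_of_find?_eq_some hf)

/-- Counting indices of a value is counting occurrences. [folklore] -/
theorem sum_ite_fin_eq_count (u : ℕ) : ∀ l : List ℕ, (∑ j : Fin l.length, if l[j.val] = u then 1 else 0) = l.count u
  | [] => by simp
  | a :: l => by
    have ih := sum_ite_fin_eq_count u l
    rw [List.count_cons]
    show (∑ j : Fin (l.length + 1), if (a :: l)[j.val] = u then 1 else 0) = _
    rw [Fin.sum_univ_succ]
    have e : (∑ j : Fin l.length, if (a :: l)[(Fin.succ j).val] = u then 1 else 0) =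
        ∑ j : Fin l.length, if l[j.val] = u then 1 else 0 := Finset.sum_congr rfl fun j _ => rfl
    have e0 : (if (a :: l)[(0 : Fin (l.length + 1)).val] = u then 1 else 0) = if a = u then 1 else 0 := rfl
    calc (if (a :: l)[(0 : Fin (l.length + 1)).val] = u then 1 else 0) +
          ∑ j : Fin l.length, (if (a :: l)[(Fin.succ j).val] = u then 1 else 0)
        = (if a = u then 1 else 0) + l.count u := by rw [e0, e, ih]
      _ = l.count u + (if (a == u) = true then 1 else 0) := by
          by_cases hau : a = u
          · simp [hau]; omega
          · simp [hau]

/-- Counting indices of a value is counting occurrences. [folklore] -/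
theorem card_filter_fin_eq_count (l : List ℕ) (u : ℕ) :
    #(univ.filter fun j : Fin l.length => l[j.val] = u) = l.count u := by
  rw [card_filter, sum_ite_fin_eq_count]

/-- **Meaning of `plur`**: on reduced masks it names the plurality of the elements
(`PolySelfCorrect.plurality`). [cite: AroraBarakCC2009, Thm. 7.10] -/
theorem elt_plur {vals : List ℕ} (hvals : ∀ v ∈ vals, v < 2 ^ (M + 1)) :
    GF2.elt M (plur vals) = plurality (fun j : Fin vals.length => GF2.elt M vals[j.val]) := by
  -- counting elements is counting masks
  have hcount : ∀ u ∈ vals, #(univ.filter fun j : Fin vals.length => GF2.elt M vals[j.val] = GF2.elt M u) = vals.count u := by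
    intro u hu
    rw [← card_filter_fin_eq_count]
    congr 1
    ext j
    simp only [mem_filter, mem_univ, true_and]
    exact ⟨fun h => GF2.elt_injective (hvals _ (List.getElem_mem j.isLt)) (hvals u hu) h, fun h => by rw [h]⟩
  rw [plur]
  cases hf : vals.find? (fun v => decide (vals.length < 2 * vals.count v)) with
  | some u =>
    have hu := List.mem_of_find?_eq_some hf
    have h1 : vals.length < 2 * vals.count u := by simpa using List.find?_some hf
    rw [Option.getD_some]
    symm
    refine plurality_eq ?_
    rw [hcount u hu]
    exact h1
  | none =>
    rw [Option.getD_none, elt_zero, plurality, dif_neg]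
    rintro ⟨v, hv⟩
    -- a plurality element occurs, so it is the element of an entry, which `find?` would have found
    have hpos : 0 < #(univ.filter fun j : Fin vals.length => GF2.elt M vals[j.val] = v) := by omega
    obtain ⟨j, hj⟩ := card_pos.1 hpos
    simp only [mem_filter, mem_univ, true_and] at hj
    have hmem : vals[j.val] ∈ vals := List.getElem_mem j.isLt
    have hnone := List.find?_eq_none.1 hf _ hmem
    simp only [decide_eq_true_eq, not_lt] at hnone
    rw [← hj, hcount _ hmem] at hv
    omega


/-! ### Meaning of the weights and of the weighted sum in `K n = GF(2^{blk n})` -/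

section Meaning

open QBFUniv

variable {n : ℕ}

/-- `elt M 1 = 1`. [folklore] -/
theorem elt_one (M : ℕ) : GF2.elt M 1 = 1 := by rw [GF2.elt, bitsPoly_one, map_one]

/-- Node masks are reduced: `c + 1 < 2^{blk n}` for `c ≤ Dn n`. [folklore] -/
theorem node_lt {c : ℕ} (hc : c ≤ Dn n) : c + 1 < 2 ^ (Mof n + 1) := by
  have := two_pow_blk_ge n; rw [show blk n = Mof n + 1 from rfl] at this; omega

/-- Distinct nonzero nodes have nonzero sum (characteristic `2`). [folklore] -/
theorem elt_node_add_ne_zero {a b : ℕ} (ha : a ≤ Dn n) (hb : b ≤ Dn n) (hab : b ≠ a) :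
    GF2.elt (Mof n) (a + 1) + GF2.elt (Mof n) (b + 1) ≠ 0 := by
  intro h0
  have h1 : GF2.elt (Mof n) (a + 1) = GF2.elt (Mof n) (b + 1) := by
    have := eq_neg_of_add_eq_zero_left h0
    rwa [CharTwo.neg_eq] at this
  exact hab (by have := GF2.elt_injective (node_lt ha) (node_lt hb) h1; omega)

/-- **The weight fold, as a product in the field**: after the nodes `< k` the accumulator is
`Π_{b < k, b ≠ a} τ_b (τ_a + τ_b)⁻¹`, reduced. [cite: AroraBarakCC2009, §19.4.2] -/
theorem elt_wt_foldl {a : ℕ} (ha : a ≤ Dn n) : ∀ k : ℕ, k ≤ Dn n + 1 →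
    GF2.elt (Mof n) ((List.range k).foldl (wtStep (kctx (Mof n)) a) 1) =
      ∏ b ∈ (Finset.range k).filter (fun b => b ≠ a),
        GF2.elt (Mof n) (b + 1) * (GF2.elt (Mof n) (a + 1) + GF2.elt (Mof n) (b + 1))⁻¹ ∧
    (List.range k).foldl (wtStep (kctx (Mof n)) a) 1 < 2 ^ (Mof n + 1)
  | 0 => fun _ => by
    simp only [List.range_zero, List.foldl_nil, Finset.range_zero, Finset.filter_empty, Finset.prod_empty]
    exact ⟨elt_one _, Nat.one_lt_two_pow (Nat.succ_ne_zero _)⟩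
  | k + 1 => fun hk => by
    obtain ⟨ih1, ih2⟩ := elt_wt_foldl ha k (by omega)
    have hkD : k ≤ Dn n := by omega
    rw [List.range_succ, List.foldl_append, List.foldl_cons, List.foldl_nil, Finset.range_add_one, Finset.filter_insert]
    set acc := (List.range k).foldl (wtStep (kctx (Mof n)) a) 1 with hacc
    by_cases hka : k = a
    · have : (k == a) = true := by simp [hka]
      rw [wtStep, if_pos this, if_neg (by simp [hka])]
      exact ⟨ih1, ih2⟩
    · have hne : ¬ ((k == a) = true) := by simpa using hka
      rw [wtStep, if_neg hne, if_pos hka, Finset.prod_insert (by simp)]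
      obtain ⟨hs1, hs2⟩ := elt_fadd (M := Mof n) (node_lt ha) (node_lt hkD)
      obtain ⟨hi1, hi2⟩ := elt_finv (M := Mof n) hs2 (by rw [hs1]; exact elt_node_add_ne_zero ha hkD hka)
      obtain ⟨hm1, hm2⟩ := elt_fmul (M := Mof n) (node_lt hkD) hi2
      obtain ⟨hp1, hp2⟩ := elt_fmul (M := Mof n) ih2 hm2
      refine ⟨?_, hp2⟩
      rw [hp1, hm1, hi1, hs1, ih1, mul_comm]

/-- **The weight is the Lagrange weight at `0`** of the node `τ_a` among `τ_0, …, τ_{Dn n}`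
(`PolySelfCorrect.weight (nodes n)`): `λ_a = Π_{b ≠ a} (τ_a − τ_b)⁻¹ (0 − τ_b) = Π_{b ≠ a} τ_b (τ_a + τ_b)⁻¹`
in characteristic `2`. [cite: AroraBarakCC2009, §19.4.2] -/
theorem elt_wt (a : Fin (Dn n + 1)) :
    GF2.elt (Mof n) (wt (kctx (Mof n)) (Dn n) a.val) = weight (nodes n) a ∧
      wt (kctx (Mof n)) (Dn n) a.val < 2 ^ (Mof n + 1) := by
  have ha : a.val ≤ Dn n := Nat.lt_succ_iff.1 a.isLt
  obtain ⟨h1, h2⟩ := elt_wt_foldl ha (Dn n + 1) le_rfl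
  refine ⟨?_, h2⟩
  rw [wt, h1, weight, Lagrange.basis, Polynomial.eval_prod, ← Finset.filter_ne', Finset.prod_filter, Finset.prod_filter]
  rw [← Fin.prod_univ_eq_prod_range (fun b => if b ≠ a.val then
    GF2.elt (Mof n) (b + 1) * (GF2.elt (Mof n) (a.val + 1) + GF2.elt (Mof n) (b + 1))⁻¹ else 1) (Dn n + 1)]
  refine Finset.prod_congr rfl fun j _ => ?_
  by_cases hja : j = a
  · rw [if_neg (not_not.2 hja), if_neg (not_not.2 (congrArg Fin.val hja))]
  · rw [if_pos hja, if_pos (Fin.val_ne_iff.2 hja), Lagrange.basisDivisor, Polynomial.eval_mul, Polynomial.eval_C, Polynomial.eval_sub,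
      Polynomial.eval_X, Polynomial.eval_C, zero_sub, CharTwo.neg_eq, GF2Str.sub_eq_add', mul_comm]
    rfl

/-- A default-read entry of a reduced list is reduced. [folklore] -/
theorem getD_lt {l : List ℕ} {B : ℕ} (hl : ∀ v ∈ l, v < 2 ^ B) (j : ℕ) : l.getD j 0 < 2 ^ B := by
  rw [List.getD_eq_getElem?_getD]
  cases h : l[j]? with
  | none => exact Nat.two_pow_pos _
  | some v => exact hl v (List.mem_of_getElem? h)

/-- **The weighted-sum fold, in the field**: after `k` terms the accumulator is `Σ_{j<k} w_j v_j`, reduced.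
[cite: AroraBarakCC2009, §19.4.2] -/
theorem elt_wsum_foldl {M : ℕ} {ws vs : List ℕ} (hws : ∀ w ∈ ws, w < 2 ^ (M + 1)) (hvs : ∀ v ∈ vs, v < 2 ^ (M + 1)) :
    ∀ k : ℕ, GF2.elt M ((List.range k).foldl (wsumStep (kctx M) ws vs) 0) =
        ∑ j ∈ Finset.range k, GF2.elt M (ws.getD j 0) * GF2.elt M (vs.getD j 0) ∧
      (List.range k).foldl (wsumStep (kctx M) ws vs) 0 < 2 ^ (M + 1)
  | 0 => by
    simp only [List.range_zero, List.foldl_nil, Finset.range_zero, Finset.sum_empty]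
    exact ⟨elt_zero M, Nat.two_pow_pos _⟩
  | k + 1 => by
    obtain ⟨ih1, ih2⟩ := elt_wsum_foldl hws hvs k
    rw [List.range_succ, List.foldl_append, List.foldl_cons, List.foldl_nil, Finset.sum_range_succ, wsumStep]
    obtain ⟨hm1, hm2⟩ := elt_fmul (M := M) (getD_lt hws k) (getD_lt hvs k)
    obtain ⟨ha1, ha2⟩ := elt_fadd (M := M) ih2 hm2
    exact ⟨by rw [ha1, hm1, ih1], ha2⟩

/-- **`wsum` is `Σ_j w_j · v_j` in the field.** [cite: AroraBarakCC2009, §19.4.2] -/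
theorem elt_wsum {M : ℕ} {ws vs : List ℕ} (hws : ∀ w ∈ ws, w < 2 ^ (M + 1)) (hvs : ∀ v ∈ vs, v < 2 ^ (M + 1)) :
    GF2.elt M (wsum (kctx M) ws vs) = ∑ j : Fin ws.length, GF2.elt M ws[j.val] * GF2.elt M (vs.getD j.val 0) ∧
      wsum (kctx M) ws vs < 2 ^ (M + 1) := by
  obtain ⟨h1, h2⟩ := elt_wsum_foldl hws hvs ws.length
  refine ⟨?_, h2⟩
  rw [wsum, h1, ← Fin.sum_univ_eq_sum_range (fun j => GF2.elt M (ws.getD j 0) * GF2.elt M (vs.getD j 0)) ws.length]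
  refine Finset.sum_congr rfl fun j _ => ?_
  rw [List.getD_eq_getElem _ _ j.isLt]

end Meaning

end TVCorr

end Literature.Computability.Complexity

end


/-!
# Part II — the approximate oracle read through an
# evaluator — blocks, query words, answer masks, the line trials and the corrected bit

Literature / complexity — derandomization under a uniform assumption (IW98 Case 2 in TV07 form), second
MACHINE layer of the random self-reduction (sequel of Part I above; counting in
`TVSelfCorrect*.lean`). The approximate description `d` is read through an arbitrary polynomial-time
evaluator `Ev` (`QBFUniv.descFn Ev d y = (Ev ⟨d, y⟩ = 1)`); a field point travels as the list of the
masks of its `N n` coordinates, and the corrector's oracle calls are the `blk n` query words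
`QBFUniv.wordPad` of a point, a selector and the pad of the trial:

* `TVCorr.natBitsL`, `TVCorr.blocksOf B N off u` (the `N` masks of the `B`-bit blocks of `u` from
  offset `off`; `elt_blocksOf_getD`: coordinate `v` is `decF` of the bits, for EVERY `u`), `TVCorr.ptStr`,
  `TVCorr.qword` (`qword_eq_wordPad`), `TVCorr.ansMask Ev d B pt π` (`elt_ansMask`: it is
  `QBFUniv.ptOracle (descFn Ev d) π`), each with its `CodeFP` form (`Ev` entering through `CodeFP.of_fn`);
* `TVCorr.trialVal` — `Σ_a λ_a · ansMask (x + τ_a y)` (`elt_trialVal`: `PolySelfCorrect.trial`),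
  `TVCorr.lineVals`/`TVCorr.valueOf` — the plurality over the lines of a trial (`elt_valueOf`:
  `PolySelfCorrect.corr`), `TVCorr.corrBitOf` — the selected bit (`corrBitOf_eq_corrected`:
  `QBFUniv.corrected`).

Everything is proved; definitions are plain functions (no named facts). The trials loop, the majority,
the parsing of the length and the evaluator `Ev'` are Part III.

## References

* [TrevisanVadhan2007] L. Trevisan, S. Vadhan, Comput. Complexity 16 (2007), Lemma 3.5, Thm. 4.3 (proof).
* [ImpagliazzoWigderson2001] R. Impagliazzo, A. Wigderson, JCSS 63 (2001), §2.2 Def. 5.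
* [AroraBarakCC2009] S. Arora, B. Barak, CUP 2009, §19.4.2, §1.3.
-/

noncomputable section

namespace Literature.Computability.Complexity

namespace TVCorr

open _root_.Computability Polynomial Finset Brick Literature.InformationTheory.Coding Literature.InformationTheory.Coding.GF2X
  UmansFP PolySelfCorrect QBFUniv
open CodeFP (strE bitE unE natE pairE rawE unitE pairE_apply rawE_cons rawE_nil length_unE length_natE)

open scoped Classical

/-! ### Bits of a mask, blocks of a string -/

/-- `natBits` as a map of the bit tests over `[0, B)`. [folklore] -/
theorem natBits_eq_map (B k : ℕ) : natBits B k = (List.range B).map fun i => k.testBit i := by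
  apply List.ext_getElem (by simp)
  intro i h1 h2
  have := GF2Str.getD_natBits B k i
  rw [List.getD_eq_getElem _ _ h1] at this
  rw [this, List.getElem_map, List.getElem_range]
  simp [show i < B by simpa using h1]

/-- **`natBits` on codes**: `(k, 1ᴮ) ↦ natBits B k`. [cite: AroraBarakCC2009, §1.3] -/
theorem natBitsC : CodeFP (pairE natE unE) strE (fun p => natBits p.2 p.1) := by
  have hbit : CodeFP (pairE (pairE natE unE) natE) bitE (fun t => t.1.1.testBit (min t.2 t.1.2)) :=
    natTestBitFP.comp ((CodeFP.fst _ _).fst'.pair (CodeFP.unOfNatMin.comp ((CodeFP.fst _ _).snd'.pair (CodeFP.snd _ _))))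
  have hmap := CodeFP.map (σ := ℕ × ℕ) (eσ := pairE natE unE) (eα := natE) (eβ := bitE) hbit
  refine ((CodeFP.bitsToStr.comp (hmap.comp ((CodeFP.id _).pair (CodeFP.urange.comp (CodeFP.snd _ _))))).congr fun p => ?_)
  rw [natBits_eq_map]
  refine List.map_congr_left fun i hi => ?_
  rw [List.mem_range] at hi
  simp [min_eq_left hi.le]

/-- Unary product on codes. [cite: AroraBarakCC2009, §1.3] -/
theorem unMulC : CodeFP (pairE unE unE) unE (fun p => p.1 * p.2) :=
  CodeFP.of_fn HashBricks.umulFn HashBricks.umulFn_mem_FP fun p => by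
    rw [pairE_apply, HashBricks.umulFn_apply, fstF_boolPair, sndF_boolPair, length_unE, length_unE, CodeFP.unE_eq_ones]

/-- **The `N` masks of the `B`-bit blocks of `u` from offset `off`** (padded with `0` past the end).
[cite: TrevisanVadhan2007, Thm. 4.3 (proof: "x takes n·t(n,i) bits")] -/
def blocksOf (B N off : ℕ) (u : List Bool) : List ℕ := (List.range N).map fun v => bitsToNat ((u.drop (off + v * B)).takeD B false)

/-- `blocksOf` on codes: `((1ᴮ, 1ᴺ), (1^off, u)) ↦ blocksOf B N off u`. [cite: AroraBarakCC2009, §1.3] -/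
theorem blocksOfC : CodeFP (pairE (pairE unE unE) (pairE unE strE)) (rawE natE) (fun p => blocksOf p.1.1 p.1.2 p.2.1 p.2.2) := by
  have hoff : CodeFP (pairE (pairE (pairE unE unE) (pairE unE strE)) natE) unE (fun t => t.1.2.1 + min t.2 t.1.1.2 * t.1.1.1) :=
    CodeFP.unAdd.comp ((CodeFP.fst _ _).snd'.fst'.pair (unMulC.comp
      ((CodeFP.unOfNatMin.comp ((CodeFP.fst _ _).fst'.snd'.pair (CodeFP.snd _ _))).pair (CodeFP.fst _ _).fst'.fst')))
  have hblk : CodeFP (pairE (pairE (pairE unE unE) (pairE unE strE)) natE) natE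
      (fun t => bitsToNat ((t.1.2.2.drop (t.1.2.1 + min t.2 t.1.1.2 * t.1.1.1)).takeD t.1.1.1 false)) :=
    CodeFP.strVal.comp (CodeFP.slice.comp (hoff.pair ((CodeFP.fst _ _).fst'.fst'.pair (CodeFP.fst _ _).snd'.snd')))
  have hmap := CodeFP.map (σ := (ℕ × ℕ) × (ℕ × List Bool)) (eσ := pairE (pairE unE unE) (pairE unE strE)) (eα := natE) (eβ := natE) hblk
  refine ((hmap.comp ((CodeFP.id _).pair (CodeFP.urange.comp (CodeFP.fst _ _).snd'))).congr fun p => ?_)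
  refine List.map_congr_left fun v hv => ?_
  rw [List.mem_range] at hv
  simp [min_eq_left hv.le]

/-- Length of `blocksOf`. [folklore] -/
@[simp] theorem length_blocksOf (B N off : ℕ) (u : List Bool) : (blocksOf B N off u).length = N := by simp [blocksOf]

/-- Reading a padded slice. [folklore] -/
theorem getD_drop_takeD (u : List Bool) (o B : ℕ) {l : ℕ} (hl : l < B) :
    ((u.drop o).takeD B false).getD l false = u.getD (o + l) false := by
  rw [Brick.getD_takeD _ _ _ hl, List.getD_eq_getElem?_getD, List.getElem?_drop, ← List.getD_eq_getElem?_getD]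

/-- The padded slice is the `ofFn` of its reads. [folklore] -/
theorem drop_takeD_eq_ofFn (u : List Bool) (o B : ℕ) :
    (u.drop o).takeD B false = List.ofFn fun l : Fin B => u.getD (o + l.val) false := by
  apply List.ext_getElem (by simp)
  intro l h1 h2
  have hl : l < B := by simpa using h2
  rw [List.getElem_ofFn, ← getD_drop_takeD u o B hl, List.getD_eq_getElem]

/-- **Block `v` of `blocksOf` is reduced and names `decF` of its bits** — for every string `u`.
[cite: TrevisanVadhan2007, Thm. 4.3 (proof)] -/
theorem elt_blocksOf_getD {M N off : ℕ} (u : List Bool) {v : ℕ} (hv : v < N) :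
    GF2.elt M ((blocksOf (M + 1) N off u).getD v 0) = decF M (fun l => u.getD (off + v * (M + 1) + l.val) false) ∧
      (blocksOf (M + 1) N off u).getD v 0 < 2 ^ (M + 1) := by
  have hget : (blocksOf (M + 1) N off u).getD v 0 = bitsToNat ((u.drop (off + v * (M + 1))).takeD (M + 1) false) := by
    rw [List.getD_eq_getElem _ _ (by simpa using hv)]
    simp [blocksOf]
  rw [hget, drop_takeD_eq_ofFn]
  exact ⟨elt_bitsToNat_ofFn _, by simpa using bitsToNat_lt (List.ofFn fun l : Fin (M + 1) => u.getD (off + v * (M + 1) + l.val) false)⟩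

/-- All blocks are reduced. [folklore] -/
theorem blocksOf_lt (B N off : ℕ) (u : List Bool) : ∀ k ∈ blocksOf B N off u, k < 2 ^ B := by
  intro k hk
  simp only [blocksOf, List.mem_map, List.mem_range] at hk
  obtain ⟨v, -, rfl⟩ := hk
  simpa using bitsToNat_lt ((u.drop (off + v * B)).takeD B false)

/-! ### Query words and answer masks -/

/-- The bit string of a point given by masks: the `B` bits of each coordinate. [folklore] -/
def ptStr (B : ℕ) (pt : List ℕ) : List Bool := (pt.map (natBits B)).flatten

/-- **The query word** of a point, a selector and a pad (`QBFUniv.wordPad` on masks). [cite: TrevisanVadhan2007, Thm. 4.3 (proof)] -/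
def qword (B : ℕ) (pt : List ℕ) (l : ℕ) (π : List Bool) : List Bool := ptStr B pt ++ natBits B l ++ π

/-- **The answer mask** at a point: the `B` answers of the description at the query words of the point,
assembled as a mask. [cite: TrevisanVadhan2007, Thm. 4.3 (proof)] -/
def ansMask (Ev : List Bool → List Bool) (d : List Bool) (B : ℕ) (pt : List ℕ) (π : List Bool) : ℕ :=
  bitsToNat ((List.range B).map fun l => decide (Ev (boolPair d (qword B pt l π)) = [true]))

/-- `ptStr` on codes: `(1ᴮ, pt) ↦ ptStr B pt`. [cite: AroraBarakCC2009, §1.3] -/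
theorem ptStrC : CodeFP (pairE unE (rawE natE)) strE (fun p => ptStr p.1 p.2) := by
  have hmap := CodeFP.map (σ := ℕ) (eσ := unE) (eα := natE) (eβ := strE) (g := fun t => natBits t.1 t.2)
    (natBitsC.comp ((CodeFP.snd _ _).pair (CodeFP.fst _ _)))
  exact (CodeFP.strFlatten.comp hmap).congr fun _ => rfl

/-- `qword` on codes: `((1ᴮ, π), (pt, l)) ↦ qword B pt l π`. [cite: AroraBarakCC2009, §1.3] -/
theorem qwordC : CodeFP (pairE (pairE unE strE) (pairE (rawE natE) natE)) strE (fun p => qword p.1.1 p.2.1 p.2.2 p.1.2) := by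
  have hB : CodeFP (pairE (pairE unE strE) (pairE (rawE natE) natE)) unE (fun t => t.1.1) := (CodeFP.fst _ _).fst'
  exact (CodeFP.strAppend.comp ((CodeFP.strAppend.comp ((ptStrC.comp (hB.pair (CodeFP.snd _ _).fst')).pair
    (natBitsC.comp ((CodeFP.snd _ _).snd'.pair hB)))).pair (CodeFP.fst _ _).snd')).congr fun _ => by simp only [qword, List.append_assoc]

section WithEv

variable {Ev : List Bool → List Bool} (hEv : Ev ∈ FP)

/-- The evaluator on codes: `(d, y) ↦ Ev ⟨d, y⟩`. [folklore] -/
theorem evC (hEv : Ev ∈ FP) : CodeFP (pairE strE strE) strE (fun p => Ev (boolPair p.1 p.2)) := CodeFP.of_fn Ev hEv fun _ => rfl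

/-- **`ansMask` on codes**: `(((1ᴮ, π), d), pt) ↦ ansMask Ev d B pt π`. [cite: AroraBarakCC2009, §1.3 and §3.4] -/
theorem ansMaskC (hEv : Ev ∈ FP) :
    CodeFP (pairE (pairE (pairE unE strE) strE) (rawE natE)) natE (fun p => ansMask Ev p.1.2 p.1.1.1 p.2 p.1.1.2) := by
  -- the answer bit at selector `l`
  have hbit : CodeFP (pairE (pairE (pairE (pairE unE strE) strE) (rawE natE)) natE) bitE
      (fun t => decide (Ev (boolPair t.1.1.2 (qword t.1.1.1.1 t.1.2 t.2 t.1.1.1.2)) = [true])) :=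
    (CodeFP.eq (α := List Bool) (eα := strE) Function.injective_id).comp
      (((evC hEv).comp ((CodeFP.fst _ _).fst'.snd'.pair (qwordC.comp ((CodeFP.fst _ _).fst'.fst'.pair
        ((CodeFP.fst _ _).snd'.pair (CodeFP.snd _ _)))))).pair (CodeFP.const _ [true]))
  have hmap := CodeFP.map (σ := ((ℕ × List Bool) × List Bool) × List ℕ)
    (eσ := pairE (pairE (pairE unE strE) strE) (rawE natE)) (eα := natE) (eβ := bitE) hbit
  exact (CodeFP.strVal.comp (CodeFP.bitsToStr.comp (hmap.comp ((CodeFP.id _).pair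
    (CodeFP.urange.comp (CodeFP.fst _ _).fst'.fst'))))).congr fun _ => rfl

end WithEv

/-! ### Meaning: query words are `wordPad`, answer masks are the point-oracle -/

section Meaning

variable {n : ℕ}

/-- `flatMap` as `flatten ∘ map`. [folklore] -/
theorem flatMap_eq_flatten_map' {α β : Type} (l : List α) (f : α → List β) : l.flatMap f = (l.map f).flatten := by
  induction l with
  | nil => rfl
  | cons a l ih => rw [List.flatMap_cons, List.map_cons, List.flatten_cons, ih]

/-- The bit string of a reduced point is `ptBits` of the point it names. [cite: TrevisanVadhan2007, Thm. 4.3 (proof)] -/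
theorem ptStr_eq_ptBits {pt : List ℕ} (hlen : pt.length = N n) (hlt : ∀ k ∈ pt, k < 2 ^ (Mof n + 1))
    (p : Fin (N n) → K n) (hp : ∀ v : Fin (N n), GF2.elt (Mof n) (pt.getD v.val 0) = p v) :
    ptStr (blk n) pt = ptBits n p := by
  rw [ptStr, ptBits, flatMap_eq_flatten_map']
  congr 1
  apply List.ext_getElem (by simp [hlen])
  intro v h1 h2
  have hv : v < N n := by simpa using h2
  have hvp : v < pt.length := by rw [hlen]; exact hv
  rw [List.getElem_map, List.getElem_map, List.getElem_finRange]
  have hk : pt[v] < 2 ^ (Mof n + 1) := hlt _ (List.getElem_mem hvp)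
  have hpv := hp ⟨v, hv⟩
  rw [List.getD_eq_getElem _ _ hvp] at hpv
  rw [natBits_eq_ofFn_encF hk, hpv]
  rfl

/-- **The query word is `wordPad`.** [cite: TrevisanVadhan2007, Thm. 4.3 (proof)] -/
theorem qword_eq_wordPad {pt : List ℕ} (hlen : pt.length = N n) (hlt : ∀ k ∈ pt, k < 2 ^ (Mof n + 1))
    (p : Fin (N n) → K n) (hp : ∀ v : Fin (N n), GF2.elt (Mof n) (pt.getD v.val 0) = p v) (l : Fin (blk n)) (π : List Bool) :
    qword (blk n) pt l.val π = wordPad n p l π := by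
  rw [qword, wordPad, ptStr_eq_ptBits hlen hlt p hp]

/-- **The answer mask is the point-oracle** of `descFn Ev d` with pad `π` (as an element; the mask is
reduced). [cite: TrevisanVadhan2007, Thm. 4.3 (proof)] -/
theorem elt_ansMask (Ev : List Bool → List Bool) (d : List Bool) {pt : List ℕ} (hlen : pt.length = N n)
    (hlt : ∀ k ∈ pt, k < 2 ^ (Mof n + 1)) (p : Fin (N n) → K n) (hp : ∀ v : Fin (N n), GF2.elt (Mof n) (pt.getD v.val 0) = p v)
    (π : List Bool) :
    GF2.elt (Mof n) (ansMask Ev d (blk n) pt π) = ptOracle (descFn Ev d) π p ∧ ansMask Ev d (blk n) pt π < 2 ^ (Mof n + 1) := by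
  have hmap : ((List.range (blk n)).map fun l => decide (Ev (boolPair d (qword (blk n) pt l π)) = [true])) =
      List.ofFn fun l : Fin (Mof n + 1) => descFn Ev d (wordPad n p l π) := by
    apply List.ext_getElem (by simp [blk])
    intro l h1 h2
    have hl : l < blk n := by simpa using h1
    rw [List.getElem_map, List.getElem_range, List.getElem_ofFn, descFn, ← qword_eq_wordPad hlen hlt p hp ⟨l, hl⟩ π]
  rw [ansMask, hmap]
  refine ⟨?_, by simpa using bitsToNat_lt (List.ofFn fun l : Fin (Mof n + 1) => descFn Ev d (wordPad n p l π))⟩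
  rw [elt_bitsToNat_ofFn]
  rfl

end Meaning

/-! ### The line trial, the plurality over the lines, the corrected bit -/

/-- The weights `λ_0, …, λ_D`. [cite: AroraBarakCC2009, §19.4.2] -/
def wts (κ : ℕ × ℕ × ℕ) (D : ℕ) : List ℕ := (List.range (D + 1)).map (wt κ D)

/-- The answer masks at the `D + 1` points `x + τ_a y` of the line. [cite: AroraBarakCC2009, §19.4.2] -/
def lineAns (Ev : List Bool → List Bool) (d : List Bool) (κ : ℕ × ℕ × ℕ) (D B : ℕ) (x y : List ℕ) (π : List Bool) : List ℕ :=
  (List.range (D + 1)).map fun a => ansMask Ev d B (linePt κ (a + 1) x y) π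

/-- **One trial**: `Σ_a λ_a · (answer at x + τ_a y)` (`PolySelfCorrect.trial` on masks). [cite: AroraBarakCC2009, §19.4.2] -/
def trialVal (Ev : List Bool → List Bool) (d : List Bool) (κ : ℕ × ℕ × ℕ) (D B : ℕ) (x y : List ℕ) (π : List Bool) : ℕ :=
  wsum κ (wts κ D) (lineAns Ev d κ D B x y π)

/-- The offsets of the `r` directions of a trial: `off + j · P`. [folklore] -/
def offsList (r P off : ℕ) : List ℕ := (List.range r).map fun j => off + j * P

/-- **The values of the `r` trials of one pad**, direction `j` read from the coins `c` at the `j`-th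
offset. [cite: TrevisanVadhan2007, Lemma 3.5] -/
def lineVals (Ev : List Bool → List Bool) (d : List Bool) (κ : ℕ × ℕ × ℕ) (D B N : ℕ) (x : List ℕ) (c π : List Bool)
    (offs : List ℕ) : List ℕ :=
  offs.map fun o => trialVal Ev d κ D B x (blocksOf B N o c) π

/-- **The corrected value** (a mask): the plurality of the trials (`PolySelfCorrect.corr` on masks).
[cite: TrevisanVadhan2007, Thm. 4.3 (proof)] -/
def valueOf (Ev : List Bool → List Bool) (d : List Bool) (κ : ℕ × ℕ × ℕ) (D B N : ℕ) (x : List ℕ) (c π : List Bool)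
    (offs : List ℕ) : ℕ :=
  plur (lineVals Ev d κ D B N x c π offs)

/-- `offsList` on codes: `(1ʳ, (1ᴾ, 1^off)) ↦ offsList r P off` (unary items). [cite: AroraBarakCC2009, §1.3] -/
theorem offsListC : CodeFP (pairE unE (pairE unE unE)) (rawE unE) (fun p => offsList p.1 p.2.1 p.2.2) := by
  have hg : CodeFP (pairE (pairE unE (pairE unE unE)) natE) unE (fun t => t.1.2.2 + min t.2 t.1.1 * t.1.2.1) :=
    CodeFP.unAdd.comp ((CodeFP.fst _ _).snd'.snd'.pair (unMulC.comp ((CodeFP.unOfNatMin.comp ((CodeFP.fst _ _).fst'.pair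
      (CodeFP.snd _ _))).pair (CodeFP.fst _ _).snd'.fst')))
  have hmap := CodeFP.map (σ := ℕ × (ℕ × ℕ)) (eσ := pairE unE (pairE unE unE)) (eα := natE) (eβ := unE) hg
  refine (hmap.comp ((CodeFP.id _).pair (CodeFP.urange.comp (CodeFP.fst _ _)))).congr fun p => ?_
  refine List.map_congr_left fun j hj => ?_
  rw [List.mem_range] at hj
  simp [min_eq_left hj.le]

/-- `wts` on codes: `(κ, 1ᴰ) ↦ wts κ D`. [cite: AroraBarakCC2009, §1.3] -/
theorem wtsC : CodeFP (pairE kctxE unE) (rawE natE) (fun p => wts p.1 p.2) := by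
  have hg : CodeFP (pairE (pairE kctxE unE) natE) natE (fun t => (List.range (t.1.2 + 1)).foldl (wtStep t.1.1 t.2) 1) :=
    wtC.comp (((CodeFP.fst _ _).fst'.pair (CodeFP.snd _ _)).pair (CodeFP.unSucc.comp (CodeFP.fst _ _).snd'))
  have hmap := CodeFP.map (σ := (ℕ × ℕ × ℕ) × ℕ) (eσ := pairE kctxE unE) (eα := natE) (eβ := natE) hg
  exact (hmap.comp ((CodeFP.id _).pair (CodeFP.urange.comp (CodeFP.unSucc.comp (CodeFP.snd _ _))))).congr fun _ => rfl

section WithEv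

variable {Ev : List Bool → List Bool}

/-- Code of the trial context `((κ, (1ᴰ, 1ᴮ)), (d, π))`. [folklore] -/
abbrev tctxE : ((ℕ × ℕ × ℕ) × (ℕ × ℕ)) × (List Bool × List Bool) → List Bool :=
  pairE (pairE kctxE (pairE unE unE)) (pairE strE strE)

/-- Code of `(tctx, (x, y))` with an item `a`. [folklore] -/
abbrev actxE : ((((ℕ × ℕ × ℕ) × (ℕ × ℕ)) × (List Bool × List Bool)) × (List ℕ × List ℕ)) × ℕ → List Bool :=
  pairE (pairE tctxE (pairE (rawE natE) (rawE natE))) natE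

/-- The line point of item `a`: `linePt κ (a+1) x y` on `((tctx, (x, y)), a)`. [cite: AroraBarakCC2009, §1.3] -/
theorem linePtAC : CodeFP actxE (rawE natE) (fun t => linePt t.1.1.1.1 (t.2 + 1) t.1.2.1 t.1.2.2) :=
  linePtC.comp ((((CodeFP.fst _ _).fst'.fst'.fst').pair (CodeFP.natAdd.comp ((CodeFP.snd _ _).pair (CodeFP.const _ 1)))).pair
    (((CodeFP.fst _ _).snd'.fst').pair ((CodeFP.fst _ _).snd'.snd')))

/-- The answer mask of item `a` on `((tctx, (x, y)), a)`. [cite: AroraBarakCC2009, §1.3 and §3.4] -/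
theorem ansAC (hEv : Ev ∈ FP) : CodeFP actxE natE
    (fun t => ansMask Ev t.1.1.2.1 t.1.1.1.2.2 (linePt t.1.1.1.1 (t.2 + 1) t.1.2.1 t.1.2.2) t.1.1.2.2) :=
  (ansMaskC hEv).comp (((((CodeFP.fst _ _).fst'.fst'.snd'.snd').pair ((CodeFP.fst _ _).fst'.snd'.snd')).pair
    ((CodeFP.fst _ _).fst'.snd'.fst')).pair linePtAC)

/-- `lineAns` on codes: `(tctx, (x, y)) ↦ lineAns Ev d κ D B x y π`. [cite: AroraBarakCC2009, §1.3 and §3.4] -/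
theorem lineAnsC (hEv : Ev ∈ FP) :
    CodeFP (pairE tctxE (pairE (rawE natE) (rawE natE))) (rawE natE)
      (fun p => lineAns Ev p.1.2.1 p.1.1.1 p.1.1.2.1 p.1.1.2.2 p.2.1 p.2.2 p.1.2.2) :=
  ((CodeFP.map (ansAC hEv)).comp ((CodeFP.id _).pair (CodeFP.urange.comp (CodeFP.unSucc.comp (CodeFP.fst _ _).fst'.snd'.fst')))).congr
    fun _ => by simp only [lineAns, id_eq]

set_option maxHeartbeats 1000000 in
/-- **`trialVal` on codes**: `(((κ, (1ᴰ, 1ᴮ)), (d, π)), (x, y)) ↦ trialVal Ev d κ D B x y π`.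
[cite: AroraBarakCC2009, §1.3 and §3.4] -/
theorem trialValC (hEv : Ev ∈ FP) :
    CodeFP (pairE tctxE (pairE (rawE natE) (rawE natE))) natE (fun p => trialVal Ev p.1.2.1 p.1.1.1 p.1.1.2.1 p.1.1.2.2 p.2.1 p.2.2 p.1.2.2) :=
  (wsumC.comp ((CodeFP.fst _ _).fst'.fst'.pair ((wtsC.comp ((CodeFP.fst _ _).fst'.fst'.pair (CodeFP.fst _ _).fst'.snd'.fst')).pair
    (lineAnsC hEv)))).congr fun _ => by dsimp only [trialVal, wts]

/-- Code of the pad context `((tctx, x), (1ᴺ, c))`; the items are the offsets (unary). [folklore] -/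
abbrev pctxE : ((((ℕ × ℕ × ℕ) × (ℕ × ℕ)) × (List Bool × List Bool)) × List ℕ) × (ℕ × List Bool) → List Bool :=
  pairE (pairE tctxE (rawE natE)) (pairE unE strE)

/-- Code of `(pctx, o)` (an offset item). [folklore] -/
abbrev octxE : (((((ℕ × ℕ × ℕ) × (ℕ × ℕ)) × (List Bool × List Bool)) × List ℕ) × (ℕ × List Bool)) × ℕ → List Bool :=
  pairE pctxE unE

/-- The direction at offset `o`: `blocksOf B N o c` on `(pctx, o)`. [cite: AroraBarakCC2009, §1.3] -/
theorem dirOC : CodeFP octxE (rawE natE) (fun t => blocksOf t.1.1.1.1.2.2 t.1.2.1 t.2 t.1.2.2) :=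
  blocksOfC.comp ((((CodeFP.fst _ _).fst'.fst'.fst'.snd'.snd').pair ((CodeFP.fst _ _).snd'.fst')).pair
    ((CodeFP.snd _ _).pair ((CodeFP.fst _ _).snd'.snd')))

set_option maxHeartbeats 1000000 in
/-- The trial value at offset `o` on `(pctx, o)`. [cite: AroraBarakCC2009, §1.3] -/
theorem trialOC (hEv : Ev ∈ FP) : CodeFP octxE natE (fun t => trialVal Ev t.1.1.1.2.1 t.1.1.1.1.1 t.1.1.1.1.2.1 t.1.1.1.1.2.2 t.1.1.2
      (blocksOf t.1.1.1.1.2.2 t.1.2.1 t.2 t.1.2.2) t.1.1.1.2.2) :=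
  ((trialValC hEv).comp (((CodeFP.fst _ _).fst'.fst').pair (((CodeFP.fst _ _).fst'.snd').pair dirOC))).congr fun _ => by dsimp only

set_option maxHeartbeats 1000000 in
/-- **`lineVals` on codes**: `(pctx, offs) ↦ lineVals …`. [cite: AroraBarakCC2009, §1.3] -/
theorem lineValsC (hEv : Ev ∈ FP) :
    CodeFP (pairE pctxE (rawE unE)) (rawE natE)
      (fun p => lineVals Ev p.1.1.1.2.1 p.1.1.1.1.1 p.1.1.1.1.2.1 p.1.1.1.1.2.2 p.1.2.1 p.1.1.2 p.1.2.2 p.1.1.1.2.2 p.2) :=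
  (CodeFP.map (eσ := pctxE) (eα := unE) (eβ := natE) (trialOC hEv)).congr fun _ => by simp only [lineVals]

/-- **`valueOf` on codes.** [cite: AroraBarakCC2009, §1.3] -/
theorem valueOfC (hEv : Ev ∈ FP) :
    CodeFP (pairE pctxE (rawE unE)) natE
      (fun p => valueOf Ev p.1.1.1.2.1 p.1.1.1.1.1 p.1.1.1.1.2.1 p.1.1.1.1.2.2 p.1.2.1 p.1.1.2 p.1.2.2 p.1.1.1.2.2 p.2) :=
  plurC.comp (lineValsC hEv)

end WithEv

/-! ### Meaning: the trial is `PolySelfCorrect.trial`, the value is `PolySelfCorrect.corr` -/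

section Meaning2

variable {n : ℕ}

/-- The weights list: entry `a` is `wt κ D a`, of length `D + 1`. [folklore] -/
theorem getD_wts (κ : ℕ × ℕ × ℕ) (D : ℕ) {a : ℕ} (ha : a < D + 1) : (wts κ D).getD a 0 = wt κ D a := by
  rw [wts, List.getD_eq_getElem _ _ (by simpa using ha)]
  simp

/-- Sums over `Fin (D+1)` and over the range agree. [folklore] -/
theorem plurality_cast {F : Type*} [Field F] [Fintype F] [DecidableEq F] {r r' : ℕ} (hr : r = r') (f : Fin r' → F) :
    plurality (fun j : Fin r => f (Fin.cast hr j)) = plurality f := by subst hr; rfl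

/-- **The trial value is `PolySelfCorrect.trial`** of the point-oracle of `descFn Ev d` with pad `π`,
with direction `q` and base point `p` (named by the reduced lists `y`, `x`). [cite: AroraBarakCC2009, §19.4.2] -/
theorem elt_trialVal (Ev : List Bool → List Bool) (d : List Bool) {x y : List ℕ} (hxl : x.length = N n) (hyl : y.length = N n)
    (hx : ∀ k ∈ x, k < 2 ^ (Mof n + 1)) (hy : ∀ k ∈ y, k < 2 ^ (Mof n + 1)) (p q : Fin (N n) → K n)
    (hp : ∀ v : Fin (N n), GF2.elt (Mof n) (x.getD v.val 0) = p v) (hq : ∀ v : Fin (N n), GF2.elt (Mof n) (y.getD v.val 0) = q v)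
    (π : List Bool) :
    GF2.elt (Mof n) (trialVal Ev d (kctx (Mof n)) (Dn n) (blk n) x y π) = trial (nodes n) (ptOracle (descFn Ev d) π) q p ∧
      trialVal Ev d (kctx (Mof n)) (Dn n) (blk n) x y π < 2 ^ (Mof n + 1) := by
  have hwts : ∀ w ∈ wts (kctx (Mof n)) (Dn n), w < 2 ^ (Mof n + 1) := by
    intro w hw
    simp only [wts, List.mem_map, List.mem_range] at hw
    obtain ⟨a, ha, rfl⟩ := hw
    exact (elt_wt (n := n) ⟨a, ha⟩).2
  have hans : ∀ w ∈ lineAns Ev d (kctx (Mof n)) (Dn n) (blk n) x y π, w < 2 ^ (Mof n + 1) := by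
    intro w hw
    simp only [lineAns, List.mem_map, List.mem_range] at hw
    obtain ⟨a, -, rfl⟩ := hw
    rw [show blk n = Mof n + 1 from rfl, ansMask]
    simpa using bitsToNat_lt ((List.range (Mof n + 1)).map fun l => decide (Ev (boolPair d (qword (Mof n + 1) (linePt (kctx (Mof n)) (a + 1) x y) l π)) = [true]))
  obtain ⟨h1, h2⟩ := elt_wsum_foldl (M := Mof n) hwts hans (Dn n + 1)
  have hlen : (wts (kctx (Mof n)) (Dn n)).length = Dn n + 1 := by simp [wts]
  refine ⟨?_, by rw [trialVal, wsum, hlen]; exact h2⟩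
  rw [trialVal, wsum, hlen, h1, trial, ← Fin.sum_univ_eq_sum_range (fun a => GF2.elt (Mof n) ((wts (kctx (Mof n)) (Dn n)).getD a 0) *
    GF2.elt (Mof n) ((lineAns Ev d (kctx (Mof n)) (Dn n) (blk n) x y π).getD a 0)) (Dn n + 1)]
  refine Finset.sum_congr rfl fun a _ => ?_
  rw [getD_wts _ _ a.isLt, (elt_wt (n := n) a).1]
  congr 1
  -- the answer at `x + τ_a y`
  have hget : (lineAns Ev d (kctx (Mof n)) (Dn n) (blk n) x y π).getD a.val 0 =
      ansMask Ev d (blk n) (linePt (kctx (Mof n)) (a.val + 1) x y) π := by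
    rw [lineAns, List.getD_eq_getElem _ _ (by simpa using a.isLt)]
    simp
  have hτ : a.val + 1 < 2 ^ (Mof n + 1) := node_lt (Nat.lt_succ_iff.1 a.isLt)
  have hxy : x.length = y.length := by rw [hxl, hyl]
  rw [hget]
  refine (elt_ansMask Ev d (by rw [length_linePt _ _ hxy, hxl]) (linePt_lt hτ hxy hx hy) (fun i => p i + nodes n a * q i) (fun v => ?_) π).1
  have hv : v.val < x.length := by rw [hxl]; exact v.isLt
  rw [(elt_linePt_get hτ hxy hx hy hv).1, hp v, hq v]
  rfl

/-- **The value is `PolySelfCorrect.corr`** with the directions decoded from the coins (`decF` of the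
blocks at `off + j · ptLen n + v · blk n`, as in `QBFUniv.decodeTrials`). [cite: TrevisanVadhan2007, Thm. 4.3 (proof)] -/
theorem elt_valueOf (Ev : List Bool → List Bool) (d : List Bool) {x : List ℕ} (hxl : x.length = N n)
    (hx : ∀ k ∈ x, k < 2 ^ (Mof n + 1)) (p : Fin (N n) → K n) (hp : ∀ v : Fin (N n), GF2.elt (Mof n) (x.getD v.val 0) = p v)
    (r off : ℕ) (c π : List Bool) :
    GF2.elt (Mof n) (valueOf Ev d (kctx (Mof n)) (Dn n) (blk n) (N n) x c π (offsList r (ptLen n) off)) =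
      corr (nodes n) (ptOracle (descFn Ev d) π)
        (fun (j : Fin r) (v : Fin (N n)) => decF (Mof n) fun l => c.getD (off + j.val * ptLen n + v.val * blk n + l.val) false) p ∧
      valueOf Ev d (kctx (Mof n)) (Dn n) (blk n) (N n) x c π (offsList r (ptLen n) off) < 2 ^ (Mof n + 1) := by
  set vals := lineVals Ev d (kctx (Mof n)) (Dn n) (blk n) (N n) x c π (offsList r (ptLen n) off) with hvals
  have hq : ∀ (j : ℕ) (v : Fin (N n)), GF2.elt (Mof n) ((blocksOf (blk n) (N n) (off + j * ptLen n) c).getD v.val 0) =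
      decF (Mof n) fun l => c.getD (off + j * ptLen n + v.val * blk n + l.val) false := fun j v =>
    (elt_blocksOf_getD (M := Mof n) (off := off + j * ptLen n) c v.isLt).1
  have htv : ∀ j : ℕ, GF2.elt (Mof n) (trialVal Ev d (kctx (Mof n)) (Dn n) (blk n) x (blocksOf (blk n) (N n) (off + j * ptLen n) c) π) =
      trial (nodes n) (ptOracle (descFn Ev d) π) (fun v => decF (Mof n) fun l => c.getD (off + j * ptLen n + v.val * blk n + l.val) false) p ∧
      trialVal Ev d (kctx (Mof n)) (Dn n) (blk n) x (blocksOf (blk n) (N n) (off + j * ptLen n) c) π < 2 ^ (Mof n + 1) := fun j =>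
    elt_trialVal Ev d hxl (length_blocksOf _ _ _ _) hx (blocksOf_lt _ _ _ _) p _ hp (hq j) π
  have hred : ∀ w ∈ vals, w < 2 ^ (Mof n + 1) := by
    intro w hw
    simp only [hvals, lineVals, offsList, List.map_map, List.mem_map, List.mem_range, Function.comp_apply] at hw
    obtain ⟨j, -, rfl⟩ := hw
    exact (htv j).2
  have hlen : vals.length = r := by simp [hvals, lineVals, offsList]
  refine ⟨?_, ?_⟩
  · rw [valueOf, ← hvals, elt_plur hred, corr, ← plurality_cast hlen]
    congr 1
    funext j
    have : vals[j.val] = trialVal Ev d (kctx (Mof n)) (Dn n) (blk n) x (blocksOf (blk n) (N n) (off + j.val * ptLen n) c) π := by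
      simp [hvals, lineVals, offsList]
    rw [this, (htv j.val).1]
    rfl
  · rcases plur_mem_or vals with h | h
    · rw [valueOf, ← hvals]; exact hred _ h
    · rw [valueOf, ← hvals, h]; exact Nat.two_pow_pos _

/-- **The selected bit of the value is `QBFUniv.corrected`** at the word `w` whose point is `p` and
selector `jOf n w`. [cite: ImpagliazzoWigderson2001, Def. 5] [cite: TrevisanVadhan2007, Thm. 4.3 (proof)] -/
theorem testBit_valueOf_eq_corrected (Ev : List Bool → List Bool) (d : List Bool) {x : List ℕ} (hxl : x.length = N n)
    (hx : ∀ k ∈ x, k < 2 ^ (Mof n + 1)) (w : List Bool) (hp : ∀ v : Fin (N n), GF2.elt (Mof n) (x.getD v.val 0) = xOf n w v)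
    (r off : ℕ) (c π : List Bool) :
    (valueOf Ev d (kctx (Mof n)) (Dn n) (blk n) (N n) x c π (offsList r (ptLen n) off)).testBit (jOf n w).val =
      corrected (descFn Ev d) n π
        (fun (j : Fin r) (v : Fin (N n)) => decF (Mof n) fun l => c.getD (off + j.val * ptLen n + v.val * blk n + l.val) false) w := by
  obtain ⟨h1, h2⟩ := elt_valueOf Ev d hxl hx (xOf n w) hp r off c π
  rw [corrected, ← h1, encF_elt h2]

end Meaning2

end TVCorr

end Literature.Computability.Complexity

end


/-!
# Part III — the trials of a coin string, the
# majority, the parsing of the length, and the evaluator `Ev'` (IW98 Def. 5 as a theorem about `FP`)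

Literature / complexity — derandomization under a uniform assumption (IW98 Case 2 in TV07 form), last
MACHINE layer of the random self-reduction (after Parts I–II above).
The evaluator reads `⟨⟨d, ⟨1ᵃ, c⟩⟩, w⟩`: it parses the size `n = nOf |w|`, the stage `i = iOf |w|` and the
layout numbers off the length (`TVCheckerParse.lean`), the field context
`kctx (Mof n) = (blk n + 1, canonIrredBits (Mof n), 2^{blk n})` (`irredSearch`, `BCHExplicitFP.lean`), rejects
non-canonical lengths, and otherwise returns the strict majority over the `trialsOf (2a)` trials read
off `c` in the layout of `QBFUniv.decodeTrials` (`TVSelfCorrectCoins.lean`) of the corrected bit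
(`TVCorr.testBit_valueOf_eq_corrected`):

* `TVCorr.majBitOf` (the core on parsed data; `majBitOf_eq_majCorrected`), its `CodeFP` form;
* the parsing (`TVCorr.nOfC`, `preC`, `DnC`, `blkC`, `ptLenC`, `mlenC`, `kctxOfC`, …);
* **`TVCorr.exists_corrector`** — for every `Ev ∈ FP` an `Ev' ∈ FP` with the two equations `hspec`,
  `hspec0` of `UniformDerandomizationRSRBridge.lean` / `UniformDerandomizationHolds.lean`.

Everything is proved; definitions are plain functions (no named facts).

## References

* [TrevisanVadhan2007] L. Trevisan, S. Vadhan, Comput. Complexity 16 (2007), Lemma 3.5, Thm. 4.3 (proof).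
* [ImpagliazzoWigderson2001] R. Impagliazzo, A. Wigderson, JCSS 63 (2001), §2.2 Defs. 4–5.
* [AroraBarakCC2009] S. Arora, B. Barak, CUP 2009, §19.4.2, §7.4.1, §1.3.
-/

noncomputable section

namespace Literature.Computability.Complexity

namespace TVCorr

open _root_.Computability Polynomial Finset Brick Literature.InformationTheory.Coding Literature.InformationTheory.Coding.GF2X
  UmansFP PolySelfCorrect QBFUniv
open CodeFP (strE bitE unE natE pairE rawE unitE pairE_apply rawE_cons rawE_nil length_unE length_natE)

open scoped Classical

/-! ### Parsing: the layout numbers of a size, the size and `pre` of a length, the field context -/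

/-- `Dn`, `blk`, `ptLen`, `mlen` of a unary size (the layout bricks of `TVCheckerParse`). [cite: TrevisanVadhan2007, Thm. 4.3 (proof)] -/
theorem layoutC : CodeFP unE unE Dn ∧ CodeFP unE unE blk ∧ CodeFP unE unE ptLen ∧ CodeFP unE unE mlen := by
  have hm := TVChk.layout_mem_FP (G := fun z => z) (PolyTimeComputable.id _)
  have hv : ∀ t : ℕ, TVChk.DnOf (fun z => z) (unE t) = ones (Dn t) ∧ TVChk.blkOf (fun z => z) (unE t) = ones (blk t) ∧
      TVChk.ptLenOf' (fun z => z) (unE t) = ones (ptLen t) ∧ TVChk.mlenOf (fun z => z) (unE t) = ones (mlen t) := fun t => by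
    have h := TVChk.layout_apply (G := fun z => z) (z := unE t) (t := t) (CodeFP.unE_eq_ones t)
    exact ⟨h.2.1, h.2.2.1, h.2.2.2.1, h.2.2.2.2.1⟩
  refine ⟨CodeFP.of_fn _ hm.2.1 fun t => ?_, CodeFP.of_fn _ hm.2.2.1 fun t => ?_,
    CodeFP.of_fn _ hm.2.2.2.1 fun t => ?_, CodeFP.of_fn _ hm.2.2.2.2.1 fun t => ?_⟩
  · rw [CodeFP.unE_eq_ones (Dn t)]; exact (hv t).1
  · rw [CodeFP.unE_eq_ones (blk t)]; exact (hv t).2.1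
  · rw [CodeFP.unE_eq_ones (ptLen t)]; exact (hv t).2.2.1
  · rw [CodeFP.unE_eq_ones (mlen t)]; exact (hv t).2.2.2

/-- `N n = 2n² + 2n` on codes. [folklore] -/
theorem NC : CodeFP unE unE N :=
  (CodeFP.unAdd.comp ((unMulC.comp ((CodeFP.const _ 2).pair (unMulC.comp ((CodeFP.id _).pair (CodeFP.id _))))).pair
    (unMulC.comp ((CodeFP.const _ 2).pair (CodeFP.id _))))).congr fun n => by simp only [id_eq]; rw [N_eq]

/-- The fuel pad `1^{30 k⁵}` of the parsers, from a unary `k`. [folklore] -/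
theorem padC : CodeFP unE unE (fun k => 30 * k ^ 5) :=
  ((CodeFP.unMulConst 30).comp ((CodeFP.ulength unitE).comp (CodeFP.unitsPow 5))).congr fun k => by simp

/-- **`pre` on codes** (`TVChk.preOf` with its fuel). [cite: TrevisanVadhan2007, Thm. 4.3 (proof)] -/
theorem preC : CodeFP unE unE pre := by
  obtain ⟨F, hF, hFv⟩ := (CodeFP.id unE).pair padC
  refine CodeFP.of_fn (TVChk.preOf ∘ F) (comp_mem_FP TVChk.preOf_mem_FP hF) fun n => ?_
  rw [Function.comp_apply, hFv, pairE_apply]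
  simp only [id_eq]
  rw [CodeFP.unE_eq_ones n, CodeFP.unE_eq_ones (30 * n ^ 5), CodeFP.unE_eq_ones (pre n), TVChk.preOf_apply]
  simp [ones]

/-- **`nOf |w|` on codes** (`TVChk.nOfF` with its fuel). [cite: TrevisanVadhan2007, Thm. 4.3 (proof)] -/
theorem nOfC : CodeFP strE unE (fun w => nOf w.length) := by
  obtain ⟨F, hF, hFv⟩ := (CodeFP.id strE).pair (padC.comp CodeFP.strLength)
  refine CodeFP.of_fn (TVChk.nOfF ∘ F) (comp_mem_FP TVChk.nOfF_mem_FP hF) fun w => ?_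
  rw [Function.comp_apply, hFv, pairE_apply]
  simp only [id_eq]
  rw [CodeFP.unE_eq_ones (30 * w.length ^ 5), CodeFP.unE_eq_ones (nOf w.length), TVChk.nOfF_apply]
  simp [ones]

/-- **The field context `kctx (Mof n)` from a unary size**: `(blk n + 1, irredSearch (blk n − 1) (Dn n + 1), 2^{blk n})`.
[cite: Umans2003, §3] -/
def kctxOf (n : ℕ) : ℕ × ℕ × ℕ := (blk n + 1, irredSearch (blk n - 1) (Dn n + 1), 2 ^ blk n)

/-- `kctxOf` is `kctx (Mof n)`. [folklore] -/
theorem kctxOf_eq (n : ℕ) : kctxOf n = kctx (Mof n) := by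
  rw [kctxOf, kctx, show blk n = Mof n + 1 from rfl, Nat.add_sub_cancel, irredSearch_eq]
  rw [Mof]
  exact Nat.pow_log_le_self 2 (Nat.succ_ne_zero _)

/-- `kctxOf` on codes (no definitional unfolding of the layout numbers: `congr` by `dsimp`).
[cite: AroraBarakCC2009, §1.3] -/
theorem kctxOfC : CodeFP unE kctxE kctxOf := by
  obtain ⟨hDn, hblk, -, -⟩ := layoutC
  have hM := MachineA.unSub.comp (hblk.pair (CodeFP.const _ 1))
  have hf := irredSearchFP.comp (hM.pair (CodeFP.unSucc.comp hDn))
  have hP := CodeFP.natPow.comp ((CodeFP.const unE 2).pair hblk)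
  refine CodeFP.congr (g' := kctxOf) ((CodeFP.unSucc.comp hblk).pair (hf.pair hP)) fun _ => ?_
  dsimp only [kctxOf]

/-! ### The core on parsed data: the corrected bit of each trial, the count, the majority -/

section Core

variable {Ev : List Bool → List Bool}

/-- **The corrected bit of trial `t`**: pad `c[tL, tL + padL)`, directions at offsets `tL + padL + j P`,
bit `jsel` of the corrected value. [cite: TrevisanVadhan2007, Lemma 3.5] -/
def trialBit (Ev : List Bool → List Bool) (d : List Bool) (κ : ℕ × ℕ × ℕ) (D B N P padL L r jsel : ℕ) (x : List ℕ)
    (c : List Bool) (t : ℕ) : Bool :=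
  (valueOf Ev d κ D B N x c ((c.drop (t * L)).takeD padL false) (offsList r P (t * L + padL))).testBit jsel

/-- **The number of trials voting `1`.** [cite: AroraBarakCC2009, §7.4.1] -/
def trialCount (Ev : List Bool → List Bool) (d : List Bool) (κ : ℕ × ℕ × ℕ) (D B N P padL L r jsel s : ℕ) (x : List ℕ)
    (c : List Bool) : ℕ :=
  ((List.range s).map fun t => if trialBit Ev d κ D B N P padL L r jsel x c t then 1 else 0).sum

/-- **The strict majority of the `s` corrected bits.** [cite: TrevisanVadhan2007, Lemma 3.5] -/
def majBitOf (Ev : List Bool → List Bool) (d : List Bool) (κ : ℕ × ℕ × ℕ) (D B N P padL L r jsel s : ℕ) (x : List ℕ)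
    (c : List Bool) : Bool :=
  decide (s < 2 * trialCount Ev d κ D B N P padL L r jsel s x c)

/-- Code of the loop context `(((κ, (1ᴰ, 1ᴮ)), (d, x)), ((1ᴺ, c), ((1ᴾ, 1^{padL}), ((1ᴸ, 1ʳ), (1^{jsel}, 1ˢ)))))`. [folklore] -/
abbrev mctxE : (((ℕ × ℕ × ℕ) × (ℕ × ℕ)) × (List Bool × List ℕ)) × ((ℕ × List Bool) × ((ℕ × ℕ) × ((ℕ × ℕ) × (ℕ × ℕ)))) → List Bool :=
  pairE (pairE (pairE kctxE (pairE unE unE)) (pairE strE (rawE natE)))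
    (pairE (pairE unE strE) (pairE (pairE unE unE) (pairE (pairE unE unE) (pairE unE unE))))

/-- Code of `(mctx, t)` (a trial index, binary). [folklore] -/
abbrev ictxE : ((((ℕ × ℕ × ℕ) × (ℕ × ℕ)) × (List Bool × List ℕ)) × ((ℕ × List Bool) × ((ℕ × ℕ) × ((ℕ × ℕ) × (ℕ × ℕ))))) × ℕ → List Bool :=
  pairE mctxE natE

/-- The trial index in unary, capped by `s`: `min t s`. [folklore] -/
theorem tUC : CodeFP ictxE unE (fun q => min q.2 q.1.2.2.2.2.2) :=
  CodeFP.unOfNatMin.comp (((CodeFP.fst _ _).snd'.snd'.snd'.snd'.snd').pair (CodeFP.snd _ _))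

/-- The offset of trial `t`'s directions: `(min t s) L + padL`. [folklore] -/
theorem offC : CodeFP ictxE unE (fun q => min q.2 q.1.2.2.2.2.2 * q.1.2.2.2.1.1 + q.1.2.2.1.2) :=
  CodeFP.unAdd.comp ((unMulC.comp (tUC.pair (CodeFP.fst _ _).snd'.snd'.snd'.fst'.fst')).pair (CodeFP.fst _ _).snd'.snd'.fst'.snd')

/-- The pad of trial `t`: `(c.drop ((min t s) L)).takeD padL false`. [folklore] -/
theorem piC : CodeFP ictxE strE (fun q => (q.1.2.1.2.drop (min q.2 q.1.2.2.2.2.2 * q.1.2.2.2.1.1)).takeD q.1.2.2.1.2 false) :=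
  CodeFP.slice.comp ((unMulC.comp (tUC.pair (CodeFP.fst _ _).snd'.snd'.snd'.fst'.fst')).pair
    (((CodeFP.fst _ _).snd'.snd'.fst'.snd').pair ((CodeFP.fst _ _).snd'.fst'.snd')))

/-- The offsets of trial `t`. [folklore] -/
theorem offsC : CodeFP ictxE (rawE unE) (fun q => offsList q.1.2.2.2.1.2 q.1.2.2.1.1 (min q.2 q.1.2.2.2.2.2 * q.1.2.2.2.1.1 + q.1.2.2.1.2)) :=
  (offsListC.comp (((CodeFP.fst _ _).snd'.snd'.snd'.fst'.snd').pair (((CodeFP.fst _ _).snd'.snd'.fst'.fst').pair offC))).congr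
    fun _ => by dsimp only

/-- The pad context of trial `t`: `((((κ, (D, B)), (d, π_t)), x), (N, c))`. [folklore] -/
theorem pctxTC : CodeFP ictxE pctxE (fun q => ((((q.1.1.1.1, (q.1.1.1.2.1, q.1.1.1.2.2)), (q.1.1.2.1,
    (q.1.2.1.2.drop (min q.2 q.1.2.2.2.2.2 * q.1.2.2.2.1.1)).takeD q.1.2.2.1.2 false)), q.1.1.2.2), (q.1.2.1.1, q.1.2.1.2))) :=
  (((((CodeFP.fst _ _).fst'.fst'.fst').pair (((CodeFP.fst _ _).fst'.fst'.snd'.fst').pair ((CodeFP.fst _ _).fst'.fst'.snd'.snd'))).pair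
    (((CodeFP.fst _ _).fst'.snd'.fst').pair piC)).pair ((CodeFP.fst _ _).fst'.snd'.snd')).pair
    (((CodeFP.fst _ _).snd'.fst'.fst').pair ((CodeFP.fst _ _).snd'.fst'.snd'))

/-- **The corrected bit of trial `min t s` on codes.** [cite: AroraBarakCC2009, §1.3] -/
theorem trialBitC (hEv : Ev ∈ FP) : CodeFP ictxE bitE (fun q => trialBit Ev q.1.1.2.1 q.1.1.1.1 q.1.1.1.2.1 q.1.1.1.2.2 q.1.2.1.1
    q.1.2.2.1.1 q.1.2.2.1.2 q.1.2.2.2.1.1 q.1.2.2.2.1.2 q.1.2.2.2.2.1 q.1.1.2.2 q.1.2.1.2 (min q.2 q.1.2.2.2.2.2)) := by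
  have hval := (valueOfC hEv).comp (pctxTC.pair offsC)
  exact (natTestBitFP.comp (hval.pair (CodeFP.fst _ _).snd'.snd'.snd'.snd'.fst')).congr fun _ => by dsimp only [trialBit]

/-- The vote of trial `min t s` as a numeral. [folklore] -/
theorem voteC (hEv : Ev ∈ FP) : CodeFP ictxE natE (fun q => if trialBit Ev q.1.1.2.1 q.1.1.1.1 q.1.1.1.2.1 q.1.1.1.2.2 q.1.2.1.1
    q.1.2.2.1.1 q.1.2.2.1.2 q.1.2.2.2.1.1 q.1.2.2.2.1.2 q.1.2.2.2.2.1 q.1.1.2.2 q.1.2.1.2 (min q.2 q.1.2.2.2.2.2) then 1 else 0) :=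
  (trialBitC hEv).ite (CodeFP.const ictxE (eβ := natE) (1 : ℕ)) (CodeFP.const ictxE (eβ := natE) (0 : ℕ))

/-- The votes of the `s` trials. [folklore] -/
theorem votesC (hEv : Ev ∈ FP) : CodeFP mctxE (rawE natE) (fun p => (List.range p.2.2.2.2.2).map fun t =>
    if trialBit Ev p.1.2.1 p.1.1.1 p.1.1.2.1 p.1.1.2.2 p.2.1.1 p.2.2.1.1 p.2.2.1.2 p.2.2.2.1.1 p.2.2.2.1.2 p.2.2.2.2.1 p.1.2.2 p.2.1.2
      (min t p.2.2.2.2.2) then 1 else 0) :=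
  ((CodeFP.map (eσ := mctxE) (eα := natE) (eβ := natE) (voteC hEv)).comp
    ((CodeFP.id _).pair (CodeFP.urange.comp (CodeFP.snd _ _).snd'.snd'.snd'.snd'))).congr fun _ => by
      simp only [id_eq]
      exact List.map_congr_left fun _ _ => rfl

/-- **The count on codes.** [cite: AroraBarakCC2009, §1.3 and §7.4.1] -/
theorem trialCountC (hEv : Ev ∈ FP) : CodeFP mctxE natE (fun p => trialCount Ev p.1.2.1 p.1.1.1 p.1.1.2.1 p.1.1.2.2 p.2.1.1
    p.2.2.1.1 p.2.2.1.2 p.2.2.2.1.1 p.2.2.2.1.2 p.2.2.2.2.1 p.2.2.2.2.2 p.1.2.2 p.2.1.2) := by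
  refine (CodeFP.natSum.comp (votesC hEv)).congr fun p => ?_
  rw [trialCount]
  exact congrArg List.sum (List.map_congr_left fun t ht => by
    rw [List.mem_range] at ht
    rw [min_eq_left ht.le])

/-- **The majority bit on codes.** [cite: TrevisanVadhan2007, Lemma 3.5] -/
theorem majBitOfC (hEv : Ev ∈ FP) : CodeFP mctxE bitE (fun p => majBitOf Ev p.1.2.1 p.1.1.1 p.1.1.2.1 p.1.1.2.2 p.2.1.1
    p.2.2.1.1 p.2.2.1.2 p.2.2.2.1.1 p.2.2.2.1.2 p.2.2.2.2.1 p.2.2.2.2.2 p.1.2.2 p.2.1.2) :=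
  (CodeFP.natLt.comp ((CodeFP.natOfUn.comp (CodeFP.snd _ _).snd'.snd'.snd'.snd').pair
    (CodeFP.natMul.comp ((CodeFP.const _ 2).pair (trialCountC hEv))))).congr fun _ => by dsimp only [majBitOf, id_eq]; rfl

end Core

/-! ### Meaning of the core: `QBFUniv.majCorrected` with the trials of `QBFUniv.decodeTrials` -/

section CoreMeaning

variable {n i : ℕ}

/-- List sums over a range are `Finset.range` sums. [folklore] -/
theorem sum_map_range (f : ℕ → ℕ) : ∀ s : ℕ, ((List.range s).map f).sum = ∑ t ∈ Finset.range s, f t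
  | 0 => by simp
  | s + 1 => by rw [List.range_succ, List.map_append, List.sum_append, Finset.sum_range_succ, sum_map_range f s]; simp

/-- The blocks of `w` from offset `0` name the point `xOf n w`. [cite: TrevisanVadhan2007, Thm. 4.3 (proof)] -/
theorem elt_blocksOf_zero (w : List Bool) (v : Fin (N n)) :
    GF2.elt (Mof n) ((blocksOf (blk n) (N n) 0 w).getD v.val 0) = xOf n w v := by
  rw [show blk n = Mof n + 1 from rfl, (elt_blocksOf_getD (M := Mof n) (off := 0) w v.isLt).1, xOf]
  congr 1
  funext l
  rw [Nat.zero_add]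

/-- **The corrected bit of trial `t` is `QBFUniv.corrected` of that trial of `decodeTrials`.**
[cite: ImpagliazzoWigderson2001, Def. 5] [cite: TrevisanVadhan2007, Lemma 3.5] -/
theorem trialBit_eq_corrected (Ev : List Bool → List Bool) (d c w : List Bool) (s : ℕ) (t : Fin s) :
    trialBit Ev d (kctx (Mof n)) (Dn n) (blk n) (N n) (ptLen n) (padLen n i) (trialLen n i) (linesOf n) (jOf n w).val
        (blocksOf (blk n) (N n) 0 w) c t.val =
      corrected (descFn Ev d) n (List.ofFn (decodeTrials n i s c t).1) (decodeTrials n i s c t).2 w := by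
  rw [trialBit, testBit_valueOf_eq_corrected Ev d (length_blocksOf _ _ _ _) (blocksOf_lt _ _ _ _) w (elt_blocksOf_zero w),
    drop_takeD_eq_ofFn]
  simp only [decodeTrials]

/-- **The majority bit is `QBFUniv.majCorrected`.** [cite: TrevisanVadhan2007, Lemma 3.5] [cite: AroraBarakCC2009, §7.4.1] -/
theorem majBitOf_eq_majCorrected (Ev : List Bool → List Bool) (d c w : List Bool) (s : ℕ) :
    majBitOf Ev d (kctx (Mof n)) (Dn n) (blk n) (N n) (ptLen n) (padLen n i) (trialLen n i) (linesOf n) (jOf n w).val s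
        (blocksOf (blk n) (N n) 0 w) c =
      majCorrected (descFn Ev d) n (decodeTrials n i s c) w := by
  have hc : trialCount Ev d (kctx (Mof n)) (Dn n) (blk n) (N n) (ptLen n) (padLen n i) (trialLen n i) (linesOf n) (jOf n w).val s
      (blocksOf (blk n) (N n) 0 w) c =
      #(univ.filter fun t : Fin s => corrected (descFn Ev d) n (List.ofFn (decodeTrials n i s c t).1) (decodeTrials n i s c t).2 w = true) := by
    rw [trialCount, sum_map_range, Finset.card_filter, ← Fin.sum_univ_eq_sum_range (fun t =>
      if trialBit Ev d (kctx (Mof n)) (Dn n) (blk n) (N n) (ptLen n) (padLen n i) (trialLen n i) (linesOf n) (jOf n w).val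
        (blocksOf (blk n) (N n) 0 w) c t then 1 else 0) s]
    refine Finset.sum_congr rfl fun t _ => ?_
    rw [trialBit_eq_corrected]
  rw [majBitOf, majCorrected, hc]

end CoreMeaning

/-! ### The evaluator: parsing `⟨⟨d, ⟨1ᵃ, c⟩⟩, w⟩` and running the core at canonical lengths -/

section Wrapper

variable {Ev : List Bool → List Bool}

/-- **The evaluator on a description `d'` and a word `w`**: reject non-canonical lengths, else the
majority bit with every number parsed off `|w|` and off `d' = ⟨d, ⟨1ᵃ, c⟩⟩`. [cite: TrevisanVadhan2007, Lemma 3.5 and Thm. 4.3 (proof)] -/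
def gW (Ev : List Bool → List Bool) (q : List Bool × List Bool) : Bool :=
  decide (pre (nOf q.2.length) + ptLen (nOf q.2.length) + blk (nOf q.2.length) ≤ q.2.length) &&
    majBitOf Ev (fstF q.1) (kctxOf (nOf q.2.length)) (Dn (nOf q.2.length)) (blk (nOf q.2.length)) (N (nOf q.2.length))
      (ptLen (nOf q.2.length)) (q.2.length - ptLen (nOf q.2.length) - blk (nOf q.2.length))
      (q.2.length - ptLen (nOf q.2.length) - blk (nOf q.2.length) + 32 * (ptLen (nOf q.2.length) + 3) * ptLen (nOf q.2.length))
      (32 * (ptLen (nOf q.2.length) + 3))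
      (min (bitsToNat ((q.2.drop (ptLen (nOf q.2.length))).take (blk (nOf q.2.length))) % blk (nOf q.2.length)) (blk (nOf q.2.length)))
      (8 * (2 * (fstF (sndF q.1)).length)) (blocksOf (blk (nOf q.2.length)) (N (nOf q.2.length)) 0 q.2) (sndF (sndF q.1))

set_option maxHeartbeats 1000000 in
/-- **`gW` on codes**: the corrector's evaluator is a polynomial-time string function.
[cite: ImpagliazzoWigderson2001, Def. 5] [cite: AroraBarakCC2009, §1.3, §3.4] -/
theorem gWC (hEv : Ev ∈ FP) : CodeFP (pairE strE strE) bitE (gW Ev) := by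
  obtain ⟨hDn, hblk, hpt, -⟩ := layoutC
  have hw := CodeFP.snd strE strE
  have hd' := CodeFP.fst strE strE
  have hm := CodeFP.strLength.comp hw
  have hn := nOfC.comp hw
  have hB := hblk.comp hn
  have hD := hDn.comp hn
  have hP := hpt.comp hn
  have hN := NC.comp hn
  have hpre := preC.comp hn
  have hκ := kctxOfC.comp hn
  have hr := (CodeFP.unMulConst 32).comp (CodeFP.unAdd.comp (hP.pair (CodeFP.const _ 3)))
  have hpadL := MachineA.unSub.comp ((MachineA.unSub.comp (hm.pair hP)).pair hB)
  have hL := CodeFP.unAdd.comp (hpadL.pair (unMulC.comp (hr.pair hP)))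
  have hfstF : CodeFP strE strE fstF := CodeFP.of_fn fstF fstF_mem_FP fun _ => rfl
  have hsndF : CodeFP strE strE sndF := CodeFP.of_fn sndF sndF_mem_FP fun _ => rfl
  have hd := hfstF.comp hd'
  have hc := hsndF.comp (hsndF.comp hd')
  have hs := (CodeFP.unMulConst 8).comp ((CodeFP.unMulConst 2).comp (CodeFP.strLength.comp (hfstF.comp (hsndF.comp hd'))))
  have hjv := CodeFP.strVal.comp (CodeFP.strTake.comp (hB.pair (CodeFP.strDrop.comp (hP.pair hw))))
  have hjsel := CodeFP.unOfNatMin.comp (hB.pair (CodeFP.natMod.comp (hjv.pair (CodeFP.natOfUn.comp hB))))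
  have hx := blocksOfC.comp ((hB.pair hN).pair ((CodeFP.const _ 0).pair hw))
  have hcanon := CodeFP.unLeNat.comp ((CodeFP.unAdd.comp ((CodeFP.unAdd.comp (hpre.pair hP)).pair hB)).pair (CodeFP.natOfUn.comp hm))
  have hmctx := ((hκ.pair (hD.pair hB)).pair (hd.pair hx)).pair ((hN.pair hc).pair ((hP.pair hpadL).pair ((hL.pair hr).pair (hjsel.pair hs))))
  have hcore := (majBitOfC hEv).comp hmctx
  exact (hcanon.and hcore).congr fun _ => by dsimp only [gW, id_eq]; rfl

/-- **At a canonical length the evaluator is the corrected majority of the trials of the coins.**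
[cite: ImpagliazzoWigderson2001, Def. 5] [cite: TrevisanVadhan2007, Lemma 3.5] -/
theorem gW_eq_majCorrected (Ev : List Bool → List Bool) {n i : ℕ} (d : List Bool) (a : ℕ) (c w : List Bool)
    (hw : w.length = h n i) :
    gW Ev (boolPair d (boolPair (ones a) c), w) = majCorrected (descFn Ev d) n (decodeTrials n i (trialsOf (2 * a)) c) w := by
  have hn : nOf w.length = n := by rw [hw, nOf_h]
  have hcan : pre n + ptLen n + blk n ≤ w.length := by rw [hw, h]; omega
  have hpad : w.length - ptLen n - blk n = padLen n i := by rw [padLen, hw]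
  have hjsel : min (bitsToNat ((w.drop (ptLen n)).take (blk n)) % blk n) (blk n) = (jOf n w).val := by
    rw [jOf]
    exact min_eq_left (Nat.mod_lt _ (blk_pos n)).le
  rw [gW]
  simp only [hn, fstF_boolPair, sndF_boolPair]
  rw [decide_eq_true hcan, Bool.true_and, hpad, hjsel, kctxOf_eq, ones, List.length_replicate,
    show padLen n i + 32 * (ptLen n + 3) * ptLen n = trialLen n i by rw [trialLen, linesOf],
    show 32 * (ptLen n + 3) = linesOf n from rfl, show 8 * (2 * a) = trialsOf (2 * a) from rfl]
  exact majBitOf_eq_majCorrected Ev d c w (trialsOf (2 * a))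

/-- **Off the canonical lengths the evaluator answers `0`.** [cite: TrevisanVadhan2007, Thm. 4.3 (proof: "for lengths k not of the form h(n,i)")] -/
theorem gW_eq_false (Ev : List Bool → List Bool) (d' w : List Bool)
    (hc : ¬ (ptLen (nOf w.length) + blk (nOf w.length) ≤ w.length - pre (nOf w.length))) : gW Ev (d', w) = false := by
  rw [TVChk.canonical_iff] at hc
  rw [gW]
  simp only
  rw [decide_eq_false hc, Bool.false_and]

/-- **THE CORRECTOR MACHINE.** For every polynomial-time evaluator `Ev` there is a polynomial-time
evaluator `Ev'` reading `⟨⟨d, ⟨1ᵃ, c⟩⟩, w⟩` at every canonical length `|w| = h n i` as the `trialsOf (2a)`-fold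
corrected majority of `y ↦ (Ev ⟨d, y⟩ = 1)` with the trials decoded from `c` (`QBFUniv.decodeTrials`), and
answering `0` off the canonical lengths — the machine content of IW98 Def. 5 / TV07 Lemma 3.5's "well-known
self-corrector for multivariate polynomials" for Trevisan–Vadhan's `F`. [cite: ImpagliazzoWigderson2001, Def. 5]
[cite: TrevisanVadhan2007, Lemma 3.5 and Thm. 4.3] [cite: AroraBarakCC2009, §19.4.2] -/
theorem exists_corrector {Ev : List Bool → List Bool} (hEv : Ev ∈ FP) :
    ∃ Ev' : List Bool → List Bool, Ev' ∈ FP ∧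
      (∀ (n i : ℕ), i ≤ mlen n → ∀ (d : List Bool) (a : ℕ) (c w : List Bool), w.length = h n i →
        coinsLen n i a ≤ c.length →
        Ev' (boolPair (boolPair d (boolPair (ones a) c)) w) =
          [majCorrected (descFn Ev d) n (decodeTrials n i (trialsOf (2 * a)) c) w]) ∧
      (∀ (d' w : List Bool), ¬ (ptLen (nOf w.length) + blk (nOf w.length) ≤ w.length - pre (nOf w.length)) →
        Ev' (boolPair d' w) = [false]) := by
  obtain ⟨F, hF, hFv⟩ := gWC hEv
  refine ⟨F, hF, fun n i _ d a c w hw _ => ?_, fun d' w hc => ?_⟩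
  · have h1 := hFv (boolPair d (boolPair (ones a) c), w)
    rw [pairE_apply] at h1
    rw [show boolPair (boolPair d (boolPair (ones a) c)) w = boolPair (strE (boolPair d (boolPair (ones a) c))) (strE w) from rfl, h1,
      gW_eq_majCorrected Ev d a c w hw]
    rfl
  · have h1 := hFv (d', w)
    rw [pairE_apply] at h1
    rw [show boolPair d' w = boolPair (strE d') (strE w) from rfl, h1, gW_eq_false Ev d' w hc]
    rfl

end Wrapper

end TVCorr

end Literature.Computability.Complexity

end
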